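import Literature.Analysis.FluidPDE.SuitableWeakSliced
import Literature.Analysis.FluidPDE.SuitableWeakStability
import Literature.Analysis.FluidPDE.TaoEnstrophyLocalisationProofs
import Literature.Analysis.FluidPDE.InitialTimeCKNExtension
import HarnessLib

/-!
# Extension by zero past a weakly vanishing final time of a suitable weak solution

Analysis/FluidPDE proof file (theorems only; no definitions, no named facts). Let `(U, P)` be a
suitable weak solution of the (unforced, `ν = 1`) Navier–Stokes system in the backward
parabolic cylinder `Q_a(0, x₀) = (−a², 0) × B(x₀, a)` (Caffarelli–Kohn–Nirenberg 1982, §2), with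
the classes **up to the top time** — `U ∈ L^∞_t L²_x` and `∇U ∈ L²` of the whole cylinder,
`U ∈ L³`, `P ∈ L^{3/2}` of the whole cylinder (as for blow-up limits; the tree's
`IsSuitableWeakSolutionInBall`) — and suppose that **`U(s) ⇀ 0` as `s → 0⁻`** in the sense
that for every smooth compactly supported field `ψ` in the ball and every `η > 0`,
`|∫ ⟪U(s), ψ⟫| ≤ η` for a.e. `s` in some `(−δ, 0)`. Then the pair extended by zero to positive
times, `Ũ(t) = U(t)` for `t < 0`, `Ũ(t) = 0` for `t ≥ 0` (and likewise `P̃`), is a suitable weak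
solution in the open box `(−a², a²) × B(x₀, a)`:

* `ZeroExtension.isSuitableWeakSolutionOn` — **the theorem**.

The point (used in the blow-up analysis of Seregin–Šverák 2002 via Caffarelli–Kohn–Nirenberg's
partial regularity at the *final* time) is that the points `(0, x)` become *interior* points
of the domain of a suitable weak solution. Proof: every condition without time derivatives
(divergence, weak spatial gradient, the classes) passes from test functions on the cylinder to
test functions on the box by smooth time cut-offs `θ_k ↑ 1_{t<0}` (dominated convergence); in
the momentum equation the cut-off produces the term `∫ θ_k'(t) ⟪U(t), ψ(t)⟫`, which tends to
`0` exactly by the weak vanishing at the final time (and the Lipschitz continuity of `ψ` in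
`t`); in the local energy inequality the corresponding term `∫∫ |U|² θ_k' φ ≤ 0` has the good
sign — the tree's sliced inequality `IsSuitableWeakSolutionOn.ae_localEnergy_slice_of_forall_lt`
(`SuitableWeakSliced.lean`) is used in its stead, letting the slice tend to the top.

## References

* L. Caffarelli, R. Kohn, L. Nirenberg, *Partial regularity of suitable weak solutions of the
  Navier–Stokes equations*, Comm. Pure Appl. Math. 35 (1982), §2. [CaffarelliKohnNirenberg1982]
* G. Seregin, V. Šverák, Arch. Ration. Mech. Anal. 163 (2002), 65–86, §4. [SereginSverak2002]
* F. Lin, CPAM 51 (1998), Def. 1, (1.4) (cut-offs vanishing near the parabolic boundary). [Lin1998]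
-/

noncomputable section

open MeasureTheory TopologicalSpace Set Function Filter Topology Metric InnerProductSpace
open scoped ENNReal NNReal RealInnerProductSpace Laplacian

namespace Literature.Analysis.FluidPDE

namespace ZeroExtension

section Geometry

variable {E : Type*} [NormedAddCommGroup E]

/-! ### Geometry of the cylinder and of the box -/

/-- The box `(−a², a²) × B(x₀, a)` is open. [folklore] -/
theorem isOpen_box (a : ℝ) (x₀ : E) : IsOpen (Ioo (-a ^ 2) (a ^ 2) ×ˢ ball x₀ a) :=
  isOpen_Ioo.prod isOpen_ball

/-- `Q_a(0, x₀) = (−a², 0) × B(x₀, a)`. [folklore] -/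
theorem parabolicCylinder_zero_eq (a : ℝ) (x₀ : E) :
    parabolicCylinder a ((0 : ℝ), x₀) = Ioo (-a ^ 2) 0 ×ˢ ball x₀ a := by
  rw [parabolicCylinder]
  simp only [zero_sub]

/-- The cylinder lies in the box. [folklore] -/
theorem parabolicCylinder_subset_box {a : ℝ} (ha : 0 < a) (x₀ : E) :
    parabolicCylinder a ((0 : ℝ), x₀) ⊆ Ioo (-a ^ 2) (a ^ 2) ×ˢ ball x₀ a := by
  rw [parabolicCylinder_zero_eq]
  exact prod_mono (Ioo_subset_Ioo le_rfl (by positivity)) subset_rfl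

/-- The negative-time part of the box is the cylinder. [folklore] -/
theorem box_inter_neg_eq {a : ℝ} (ha : 0 < a) (x₀ : E) :
    (Ioo (-a ^ 2) (a ^ 2) ×ˢ ball x₀ a) ∩ {z : ℝ × E | z.1 < 0} =
      parabolicCylinder a ((0 : ℝ), x₀) := by
  rw [parabolicCylinder_zero_eq]
  ext ⟨t, x⟩
  simp only [mem_inter_iff, mem_prod, mem_Ioo, mem_setOf_eq]
  constructor
  · rintro ⟨⟨⟨h1, -⟩, h3⟩, h4⟩; exact ⟨⟨h1, h4⟩, h3⟩
  · rintro ⟨⟨h1, h2⟩, h3⟩; exact ⟨⟨⟨h1, h2.trans (by positivity)⟩, h3⟩, h2⟩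

/-- A set inside the box meets every lower half-space `{t ≤ τ}`, `τ < 0`, inside the cylinder. [folklore] -/
theorem inter_le_subset_parabolicCylinder {a : ℝ} (ha : 0 < a) (x₀ : E) {S : Set (ℝ × E)}
    (hS : S ⊆ Ioo (-a ^ 2) (a ^ 2) ×ˢ ball x₀ a) {τ : ℝ} (hτ : τ < 0) :
    S ∩ {z : ℝ × E | z.1 ≤ τ} ⊆ parabolicCylinder a ((0 : ℝ), x₀) := by
  rw [← box_inter_neg_eq ha]
  rintro z ⟨hz, hzτ⟩
  exact ⟨hS hz, lt_of_le_of_lt hzτ hτ⟩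

end Geometry

section Test

variable {E : Type*} [NormedAddCommGroup E] [InnerProductSpace ℝ E]

/-! ### Test functions on the box, cut off in time, are test functions on the cylinder -/

/-- Multiplying a space–time test field by a smooth function of time gives a test field on the
same region (the tree's `IsSpaceTimeTestOn.time_smul`, restated to keep the imports light). [folklore] -/
theorem isSpaceTimeTestOn_time_smul_field {F : Type*} [NormedAddCommGroup F] [NormedSpace ℝ F]
    {Q : Opens (ℝ × E)} {ψ : ℝ → E → F} (hψ : IsSpaceTimeTestOn Q ψ) {θ : ℝ → ℝ}
    (hθ : ContDiff ℝ (⊤ : ℕ∞) θ) : IsSpaceTimeTestOn Q (fun s y => θ s • ψ s y) := by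
  have e : uncurry (fun s y => θ s • ψ s y) = fun z : ℝ × E => θ z.1 • uncurry ψ z := rfl
  refine ⟨?_, ?_, ?_⟩
  · rw [e]; exact (hθ.comp contDiff_fst).smul hψ.contDiff
  · rw [e]; exact hψ.hasCompactSupport.smul_left
  · rw [e]; exact (tsupport_smul_subset_right (fun z : ℝ × E => θ z.1) (uncurry ψ)).trans
      hψ.tsupport_subset

/-- The time cut-off `θ(t) • ψ(t, x)` of a test field on the box by a smooth `θ` vanishing on
`[−δ, ∞)`, `δ > 0`, is a test field on the cylinder. [folklore] -/
theorem isSpaceTimeTestOn_cutoff_smul {F : Type*} [NormedAddCommGroup F] [NormedSpace ℝ F]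
    {a : ℝ} (ha : 0 < a) (x₀ : E) {ψ : ℝ → E → F}
    (hψ : IsSpaceTimeTestOn ⟨Ioo (-a ^ 2) (a ^ 2) ×ˢ ball x₀ a, isOpen_box a x₀⟩ ψ)
    {θ : ℝ → ℝ} (hθs : ContDiff ℝ (⊤ : ℕ∞) θ) {δ : ℝ} (hδ : 0 < δ)
    (hθ0 : ∀ t, -δ ≤ t → θ t = 0) :
    IsSpaceTimeTestOn (parabolicCylinderOpens a ((0 : ℝ), x₀)) (fun t x => θ t • ψ t x) := by
  refine (isSpaceTimeTestOn_time_smul_field hψ hθs).of_tsupport_subset ?_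
  rw [coe_parabolicCylinderOpens]
  intro z hz
  have hz1 : z ∈ tsupport (uncurry ψ) :=
    tsupport_smul_subset_right (fun z : ℝ × E => θ z.1) (uncurry ψ) hz
  have hz2 : z.1 ≤ -δ := by
    by_contra h
    push Not at h
    -- `θ = 0` on a neighbourhood of `z.1`, hence `z ∉ tsupport`
    have hnhds : ∀ᶠ w in 𝓝 z, (fun w : ℝ × E => θ w.1 • uncurry ψ w) w = 0 := by
      have : ∀ᶠ w in 𝓝 z, -δ < w.1 := (continuous_fst.tendsto z).eventually (lt_mem_nhds h)
      filter_upwards [this] with w hw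
      show θ w.1 • uncurry ψ w = 0
      rw [hθ0 _ hw.le, zero_smul]
    exact (notMem_tsupport_iff_eventuallyEq.2 hnhds) hz
  exact inter_le_subset_parabolicCylinder ha x₀ hψ.tsupport_subset (by linarith : -δ < (0 : ℝ))
    ⟨hz1, hz2⟩

end Test

variable {E : Type*} [NormedAddCommGroup E] [InnerProductSpace ℝ E] [FiniteDimensional ℝ E]
  [MeasurableSpace E] [BorelSpace E]

/-! ### The classes of the pair up to the top, as integrability on the cylinder -/

section Classes

variable {a : ℝ} {x₀ : E} {U : ℝ → E → E} {P : ℝ → E → ℝ}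

/-- From `U ∈ L^∞_t L²_x` of the cylinder: `∫⁻_{Q_a} ‖U‖ₑ² < ∞`. [folklore] -/
theorem lintegral_cylinder_norm_sq_lt_top
    (hUm : AEStronglyMeasurable (uncurry U) (volume.restrict (parabolicCylinder a ((0 : ℝ), x₀))))
    {C : ℝ≥0} (hE : ∀ᵐ t ∂(volume.restrict (Ioo (-a ^ 2) 0)), ∫⁻ x in ball x₀ a, ‖U t x‖ₑ ^ 2 ≤ C) :
    ∫⁻ z in parabolicCylinder a ((0 : ℝ), x₀), ‖U z.1 z.2‖ₑ ^ 2 < ⊤ := by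
  rw [parabolicCylinder_zero_eq] at hUm ⊢
  rw [Measure.volume_eq_prod, ← Measure.prod_restrict,
    lintegral_prod _ (by
      have := hUm.aemeasurable.enorm.pow_const 2
      rwa [Measure.volume_eq_prod, ← Measure.prod_restrict] at this)]
  calc ∫⁻ t in Ioo (-a ^ 2) 0, ∫⁻ x in ball x₀ a, ‖U t x‖ₑ ^ 2
      ≤ ∫⁻ _ in Ioo (-a ^ 2) (0 : ℝ), (C : ℝ≥0∞) := lintegral_mono_ae hE
    _ < ⊤ := by
        rw [setLIntegral_const]
        exact ENNReal.mul_lt_top ENNReal.coe_lt_top measure_Ioo_lt_top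

/-- `U ∈ L²(Q_a)` as a real integrability statement. [folklore] -/
theorem integrableOn_norm_sq
    (hUm : AEStronglyMeasurable (uncurry U) (volume.restrict (parabolicCylinder a ((0 : ℝ), x₀))))
    {C : ℝ≥0} (hE : ∀ᵐ t ∂(volume.restrict (Ioo (-a ^ 2) 0)), ∫⁻ x in ball x₀ a, ‖U t x‖ₑ ^ 2 ≤ C) :
    IntegrableOn (fun z : ℝ × E => ‖U z.1 z.2‖ ^ 2) (parabolicCylinder a ((0 : ℝ), x₀)) := by
  have hmem : MemLp (uncurry U) 2 (volume.restrict (parabolicCylinder a ((0 : ℝ), x₀))) := by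
    refine ⟨hUm, ?_⟩
    rw [eLpNorm_lt_top_iff_lintegral_rpow_enorm_lt_top two_ne_zero ENNReal.ofNat_ne_top]
    have h := lintegral_cylinder_norm_sq_lt_top hUm hE
    simp only [ENNReal.toReal_ofNat, ENNReal.rpow_ofNat]
    exact h
  exact hmem.integrable_norm_pow two_ne_zero

/-- `U ∈ L¹(Q_a)`. [folklore] -/
theorem integrableOn_velocity
    (hUm : AEStronglyMeasurable (uncurry U) (volume.restrict (parabolicCylinder a ((0 : ℝ), x₀))))
    {C : ℝ≥0} (hE : ∀ᵐ t ∂(volume.restrict (Ioo (-a ^ 2) 0)), ∫⁻ x in ball x₀ a, ‖U t x‖ₑ ^ 2 ≤ C) :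
    IntegrableOn (uncurry U) (parabolicCylinder a ((0 : ℝ), x₀)) := by
  have h2 := integrableOn_norm_sq hUm hE
  have hfin : volume (parabolicCylinder a ((0 : ℝ), x₀)) < ⊤ := by
    rw [parabolicCylinder_zero_eq]
    exact ((isCompact_Icc.prod (isCompact_closedBall x₀ a)).measure_lt_top).trans_le'
      (measure_mono (prod_mono Ioo_subset_Icc_self ball_subset_closedBall))
  refine ((integrableOn_const (C := (1 : ℝ)) hfin.ne).add h2).mono' hUm
    (Eventually.of_forall fun z => ?_)
  show ‖U z.1 z.2‖ ≤ 1 + ‖U z.1 z.2‖ ^ 2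
  nlinarith [norm_nonneg (U z.1 z.2), sq_nonneg (‖U z.1 z.2‖ - 1)]

/-- `U ∈ L³(Q_a)` as a real integrability statement. [folklore] -/
theorem integrableOn_norm_cube
    (hU3 : MemLp (uncurry U) 3 (volume.restrict (parabolicCylinder a ((0 : ℝ), x₀)))) :
    IntegrableOn (fun z : ℝ × E => ‖U z.1 z.2‖ ^ 3) (parabolicCylinder a ((0 : ℝ), x₀)) := by
  have := hU3.integrable_norm_pow (p := 3) (by norm_num)
  exact this

/-- `P ∈ L¹(Q_a)` and `|P|^{3/2} ∈ L¹(Q_a)`. [folklore] -/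
theorem integrableOn_pressure
    (hP : MemLp (uncurry P) (3 / 2) (volume.restrict (parabolicCylinder a ((0 : ℝ), x₀)))) :
    IntegrableOn (uncurry P) (parabolicCylinder a ((0 : ℝ), x₀)) ∧
      IntegrableOn (fun z : ℝ × E => |P z.1 z.2| ^ (3 / 2 : ℝ)) (parabolicCylinder a ((0 : ℝ), x₀)) := by
  have hfin : volume (parabolicCylinder a ((0 : ℝ), x₀)) < ⊤ := by
    rw [parabolicCylinder_zero_eq]
    exact ((isCompact_Icc.prod (isCompact_closedBall x₀ a)).measure_lt_top).trans_le'
      (measure_mono (prod_mono Ioo_subset_Icc_self ball_subset_closedBall))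
  haveI : IsFiniteMeasure (volume.restrict (parabolicCylinder a ((0 : ℝ), x₀))) :=
    ⟨by rw [Measure.restrict_apply_univ]; exact hfin⟩
  have h32 : ((3 : ℝ≥0∞) / 2).toReal = (3 / 2 : ℝ) := by rw [ENNReal.toReal_div]; norm_num
  refine ⟨MemLp.integrable (by
      rw [← ENNReal.div_self two_ne_zero ENNReal.ofNat_ne_top]
      exact ENNReal.div_le_div_right (by norm_num) 2) hP, ?_⟩
  have h := hP.integrable_norm_rpow (by simp) (by simp [ENNReal.div_eq_top])
  rw [h32] at h
  have e : (fun z : ℝ × E => |P z.1 z.2| ^ (3 / 2 : ℝ)) = fun z => ‖uncurry P z‖ ^ (3 / 2 : ℝ) := by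
    funext z; rw [Real.norm_eq_abs]; rfl
  rw [e]
  exact h

/-- The cubic and the pressure–velocity terms: `(‖U‖² + 2|P|) ‖U‖ ∈ L¹(Q_a)`. [folklore] -/
theorem integrableOn_flux
    (hUm : AEStronglyMeasurable (uncurry U) (volume.restrict (parabolicCylinder a ((0 : ℝ), x₀))))
    (hU3 : MemLp (uncurry U) 3 (volume.restrict (parabolicCylinder a ((0 : ℝ), x₀))))
    (hP : MemLp (uncurry P) (3 / 2) (volume.restrict (parabolicCylinder a ((0 : ℝ), x₀)))) :
    IntegrableOn (fun z : ℝ × E => (‖U z.1 z.2‖ ^ 2 + 2 * |P z.1 z.2|) * ‖U z.1 z.2‖)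
      (parabolicCylinder a ((0 : ℝ), x₀)) := by
  have h3 := integrableOn_norm_cube hU3
  obtain ⟨-, hP32⟩ := integrableOn_pressure hP
  -- Young: `|P| ‖U‖ ≤ (2/3)|P|^{3/2} + (1/3)‖U‖³`
  have hY : ∀ z : ℝ × E, |P z.1 z.2| * ‖U z.1 z.2‖ ≤
      |P z.1 z.2| ^ (3 / 2 : ℝ) / (3 / 2) + ‖U z.1 z.2‖ ^ (3 : ℝ) / 3 := fun z =>
    Real.young_inequality_of_nonneg (abs_nonneg _) (norm_nonneg _)
      (Real.holderConjugate_iff.2 ⟨by norm_num, by norm_num⟩)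
  have hdom : IntegrableOn (fun z : ℝ × E => ‖U z.1 z.2‖ ^ 3 +
      2 * (|P z.1 z.2| ^ (3 / 2 : ℝ) / (3 / 2) + ‖U z.1 z.2‖ ^ 3 / 3))
      (parabolicCylinder a ((0 : ℝ), x₀)) :=
    h3.add (((hP32.div_const (3 / 2)).add (h3.div_const 3)).const_mul 2)
  have hPm : AEStronglyMeasurable (fun z : ℝ × E => |P z.1 z.2|)
      (volume.restrict (parabolicCylinder a ((0 : ℝ), x₀))) := hP.aestronglyMeasurable.norm
  refine hdom.mono' (((hUm.norm.pow 2).add (hPm.const_mul 2)).mul hUm.norm)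
    (Eventually.of_forall fun z => ?_)
  have hU0 : 0 ≤ ‖U z.1 z.2‖ := norm_nonneg _
  rw [Real.norm_eq_abs, abs_of_nonneg (by positivity)]
  have e3 : ‖U z.1 z.2‖ ^ (3 : ℝ) = ‖U z.1 z.2‖ ^ 3 := by norm_cast
  have hYz := hY z
  rw [e3] at hYz
  show (‖U z.1 z.2‖ ^ 2 + 2 * |P z.1 z.2|) * ‖U z.1 z.2‖ ≤
    ‖U z.1 z.2‖ ^ 3 + 2 * (|P z.1 z.2| ^ (3 / 2 : ℝ) / (3 / 2) + ‖U z.1 z.2‖ ^ 3 / 3)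
  nlinarith

end Classes

/-! ### Smooth time cut-offs exhausting `{t < 0}` from below -/

omit [InnerProductSpace ℝ E] [FiniteDimensional ℝ E] [MeasurableSpace E] [BorelSpace E] in
/-- **Cut-offs below the final time.** For `δ > 0` there are a smooth `θ : ℝ → ℝ` and its
derivative `ρ` with `θ = 1` on `(-∞, -3δ]`, `θ = 0` on `[-δ, ∞)`, `0 ≤ θ ≤ 1`, `ρ ≤ 0`
supported in `(-3δ, -δ)`, `ρ` integrable with `∫ |ρ| = 1`. [folklore] -/
theorem exists_top_cutoff {δ : ℝ} (hδ : 0 < δ) :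
    ∃ θ ρ : ℝ → ℝ, ContDiff ℝ (⊤ : ℕ∞) θ ∧ (∀ t, HasDerivAt θ (ρ t) t) ∧
      (∀ t, t ≤ -(3 * δ) → θ t = 1) ∧ (∀ t, -δ ≤ t → θ t = 0) ∧ (∀ t, θ t ∈ Icc (0 : ℝ) 1) ∧
      (∀ t, ρ t ≤ 0) ∧ (∀ t, t ∉ Ioo (-(3 * δ)) (-δ) → ρ t = 0) ∧ Continuous ρ ∧
      Integrable ρ ∧ ∫ t, |ρ t| = 1 := by
  obtain ⟨η, ρ₀, hηs, hρc, hηd, hη0, hη1, hη01, hρ0, hρsupp, hρint⟩ := exists_smooth_time_cutoff hδ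
  have hρ₀i : Integrable ρ₀ := by
    refine hρc.integrable_of_hasCompactSupport ?_
    refine HasCompactSupport.intro (isCompact_Icc (a := δ) (b := 3 * δ)) fun s hs => hρsupp s ?_
    exact fun h => hs (Ioo_subset_Icc_self h)
  refine ⟨fun t => η (-t), fun t => -ρ₀ (-t), hηs.comp contDiff_neg, fun t => ?_,
    fun t ht => hη1 _ (by linarith), fun t ht => hη0 _ (by linarith), fun t => hη01 _,
    fun t => by linarith [hρ0 (-t)], fun t ht => ?_, (hρc.comp continuous_neg).neg,
    (hρ₀i.comp_neg).neg, ?_⟩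
  · have h1 : HasDerivAt (fun t : ℝ => -t) (-1) t := hasDerivAt_neg t
    have h2 := (hηd (-t)).comp t h1
    show HasDerivAt (fun t => η (-t)) (-ρ₀ (-t)) t
    exact h2.congr_deriv (by ring)
  · show -ρ₀ (-t) = 0
    rw [hρsupp _ (fun h => ht ⟨by linarith [h.2], by linarith [h.1]⟩), neg_zero]
  · have : (fun t => |(-ρ₀ (-t))|) = fun t => ρ₀ (-t) := by
      funext t; rw [abs_neg, abs_of_nonneg (hρ0 _)]
    rw [this, integral_neg_eq_self (fun t => ρ₀ t) volume]
    exact hρint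

/-! ### The pairing `∫ ρ(t) ⟪U(t), ψ(t)⟫` against cut-off derivatives near the final time -/

section Pairing

variable {a : ℝ} {x₀ : E} {U : ℝ → E → E} {P : ℝ → E → ℝ}

omit [InnerProductSpace ℝ E] [FiniteDimensional ℝ E] [BorelSpace E] in
/-- `∫ ‖f‖² ≤ C` from `∫⁻ ‖f‖ₑ² ≤ C`. [folklore] -/
theorem integral_norm_sq_le_of_lintegral_le {f : E → E} {μ : Measure E} (hf : AEStronglyMeasurable f μ)
    {C : ℝ≥0} (h : ∫⁻ x, ‖f x‖ₑ ^ 2 ∂μ ≤ C) : ∫ x, ‖f x‖ ^ 2 ∂μ ≤ C := by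
  rw [integral_eq_lintegral_of_nonneg_ae (Eventually.of_forall fun x => by positivity)
    (hf.norm.aemeasurable.pow_const 2).aestronglyMeasurable]
  have h' : ∫⁻ x, ENNReal.ofReal (‖f x‖ ^ 2) ∂μ ≤ C := by
    refine le_trans (le_of_eq (lintegral_congr fun x => ?_)) h
    rw [← ofReal_norm, ENNReal.ofReal_pow (norm_nonneg _)]
  calc (∫⁻ x, ENNReal.ofReal (‖f x‖ ^ 2) ∂μ).toReal ≤ ((C : ℝ≥0) : ℝ≥0∞).toReal :=
        ENNReal.toReal_mono ENNReal.coe_ne_top h'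
    _ = C := ENNReal.coe_toReal C

/-- **Slice bounds.** From `U ∈ L^∞_t L²_x` of the cylinder: for a.e. `t ∈ (-a², 0)`, `U(t)` is
integrable on the ball and `∫_{B} ‖U(t)‖ ≤ |B| + C`. [folklore] -/
theorem ae_slice_bounds
    (hUm : AEStronglyMeasurable (uncurry U) (volume.restrict (parabolicCylinder a ((0 : ℝ), x₀))))
    {C : ℝ≥0} (hE : ∀ᵐ t ∂(volume.restrict (Ioo (-a ^ 2) 0)), ∫⁻ x in ball x₀ a, ‖U t x‖ₑ ^ 2 ≤ C) :
    ∀ᵐ t ∂(volume.restrict (Ioo (-a ^ 2) 0)),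
      IntegrableOn (fun x => U t x) (ball x₀ a) ∧
        ∫ x in ball x₀ a, ‖U t x‖ ≤ volume.real (ball x₀ a) + C := by
  rw [parabolicCylinder_zero_eq, Measure.volume_eq_prod, ← Measure.prod_restrict] at hUm
  filter_upwards [hE, hUm.prodMk_left] with t ht htm
  have hfin : volume (ball x₀ a) < ⊤ := measure_ball_lt_top
  haveI : IsFiniteMeasure (volume.restrict (ball x₀ a)) := ⟨by rw [Measure.restrict_apply_univ]; exact hfin⟩
  have hmem : MemLp (fun x => U t x) 2 (volume.restrict (ball x₀ a)) := by
    refine ⟨htm, ?_⟩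
    rw [eLpNorm_lt_top_iff_lintegral_rpow_enorm_lt_top two_ne_zero ENNReal.ofNat_ne_top]
    simp only [ENNReal.toReal_ofNat, ENNReal.rpow_ofNat]
    exact ht.trans_lt ENNReal.coe_lt_top
  have h2 : IntegrableOn (fun x => ‖U t x‖ ^ 2) (ball x₀ a) := hmem.integrable_norm_pow two_ne_zero
  have h1 : IntegrableOn (fun x => U t x) (ball x₀ a) :=
    hmem.integrable (by norm_num)
  refine ⟨h1, ?_⟩
  have hI2 : ∫ x in ball x₀ a, ‖U t x‖ ^ 2 ≤ C := by
    exact integral_norm_sq_le_of_lintegral_le htm ht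
  calc ∫ x in ball x₀ a, ‖U t x‖ ≤ ∫ x in ball x₀ a, (1 + ‖U t x‖ ^ 2) := by
        refine setIntegral_mono_on h1.norm ((integrableOn_const (C := (1 : ℝ)) hfin.ne).add h2)
          measurableSet_ball fun x _ => ?_
        nlinarith [norm_nonneg (U t x), sq_nonneg (‖U t x‖ - 1)]
    _ = volume.real (ball x₀ a) + ∫ x in ball x₀ a, ‖U t x‖ ^ 2 := by
        rw [integral_add (integrableOn_const (C := (1 : ℝ)) hfin.ne) h2, setIntegral_const,
          smul_eq_mul, mul_one]
    _ ≤ volume.real (ball x₀ a) + C := by linarith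

/-- Fubini on the cylinder `Q_a(0, x₀) = (-a², 0) × B(x₀, a)`. [folklore] -/
theorem setIntegral_cylinder_eq_iterated {F : Type*} [NormedAddCommGroup F] [NormedSpace ℝ F]
    {f : ℝ × E → F} (hf : IntegrableOn f (parabolicCylinder a ((0 : ℝ), x₀))) :
    ∫ z in parabolicCylinder a ((0 : ℝ), x₀), f z =
      ∫ t in Ioo (-a ^ 2) 0, ∫ x in ball x₀ a, f (t, x) := by
  rw [parabolicCylinder_zero_eq] at hf ⊢
  rw [Measure.volume_eq_prod, setIntegral_prod f (by rw [← Measure.volume_eq_prod]; exact hf)]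

/-- **The cut-off term is small near the final time.** Under the weak vanishing of `U(s)` as
`s → 0⁻`, for every test field `ψ` on the box and `η > 0` there is `δ₀ > 0` such that for every
continuous `ρ` supported in `(-3δ, -δ)` with `3δ ≤ δ₀` and `∫ |ρ| = 1`:
`|∫_{Q_a} ρ(t) ⟪U, ψ⟫| ≤ η`. [folklore] -/
theorem abs_setIntegral_cutoff_pairing_le (ha : 0 < a)
    (hUm : AEStronglyMeasurable (uncurry U) (volume.restrict (parabolicCylinder a ((0 : ℝ), x₀))))
    {C : ℝ≥0} (hE : ∀ᵐ t ∂(volume.restrict (Ioo (-a ^ 2) 0)), ∫⁻ x in ball x₀ a, ‖U t x‖ₑ ^ 2 ≤ C)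
    (hvan : ∀ φ : E → E, ContDiff ℝ (⊤ : ℕ∞) φ → HasCompactSupport φ → tsupport φ ⊆ ball x₀ a →
      ∀ η > 0, ∃ δ > 0, ∀ᵐ s ∂(volume : Measure ℝ), s ∈ Ioo (-δ) 0 → |∫ x, ⟪U s x, φ x⟫| ≤ η)
    {ψ : ℝ → E → E}
    (hψ : IsSpaceTimeTestOn ⟨Ioo (-a ^ 2) (a ^ 2) ×ˢ ball x₀ a, isOpen_box a x₀⟩ ψ)
    {η : ℝ} (hη : 0 < η) :
    ∃ δ₀ > 0, ∀ {δ : ℝ}, 0 < δ → 3 * δ ≤ δ₀ → ∀ {ρ : ℝ → ℝ}, Continuous ρ →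
      (∀ t, t ∉ Ioo (-(3 * δ)) (-δ) → ρ t = 0) → ∫ t, |ρ t| = 1 →
      |∫ z in parabolicCylinder a ((0 : ℝ), x₀), ρ z.1 * ⟪U z.1 z.2, ψ z.1 z.2⟫| ≤ η := by
  -- the final slice of the test field, and the weak vanishing against it
  have hψ0 : ContDiff ℝ (⊤ : ℕ∞) (ψ 0) := hψ.contDiff_slice 0
  have hψ0supp : tsupport (ψ 0) ⊆ ball x₀ a := by
    have hcont : Continuous fun x : E => ((0 : ℝ), x) := by fun_prop
    have h1 : tsupport (ψ 0) ⊆ (fun x : E => ((0 : ℝ), x)) ⁻¹' tsupport (uncurry ψ) := by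
      refine closure_minimal (fun x hx => subset_tsupport _ ?_) ((isClosed_tsupport _).preimage hcont)
      simpa [Function.mem_support] using hx
    intro x hx
    have h2 : ((0 : ℝ), x) ∈ Ioo (-a ^ 2) (a ^ 2) ×ˢ ball x₀ a := hψ.tsupport_subset (h1 hx)
    exact h2.2
  have hψ0c : HasCompactSupport (ψ 0) := by
    refine HasCompactSupport.intro (isCompact_closedBall x₀ a) fun x hx => ?_
    exact image_eq_zero_of_notMem_tsupport fun h => hx (ball_subset_closedBall (hψ0supp h))
  obtain ⟨δ₁, hδ₁, hv⟩ := hvan (ψ 0) hψ0 hψ0c hψ0supp (η / 2) (half_pos hη)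
  -- the test field is Lipschitz in time and bounded
  obtain ⟨L, hL⟩ := ContDiff.lipschitzWith_of_hasCompactSupport hψ.hasCompactSupport hψ.contDiff
    (by simp)
  have hLip : ∀ t x, ‖ψ t x - ψ 0 x‖ ≤ L * |t| := by
    intro t x
    have h := hL.dist_le_mul (t, x) (0, x)
    rw [dist_eq_norm, Prod.dist_eq, dist_self, Real.dist_eq, sub_zero,
      max_eq_left (abs_nonneg t)] at h
    exact h
  obtain ⟨Bψ, hBψ⟩ := hψ.hasCompactSupport.exists_bound_of_continuous hψ.contDiff.continuous
  have hBψ' : ∀ t x, ‖ψ t x‖ ≤ Bψ := fun t x => hBψ (t, x)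
  have hBψ0 : 0 ≤ Bψ := (norm_nonneg _).trans (hBψ ((0 : ℝ), x₀))
  -- the slice bounds
  set M : ℝ := volume.real (ball x₀ a) + C with hM
  have hM0 : 0 ≤ M := by positivity
  have hsl := ae_slice_bounds hUm hE
  -- the threshold
  refine ⟨min δ₁ (min (a ^ 2) (η / (2 * (L * M + 1)))), lt_min hδ₁ (lt_min (by positivity)
    (by positivity)), ?_⟩
  intro δ hδ h3δ ρ hρc hρsupp hρ1
  have h3δ₁ : 3 * δ ≤ δ₁ := h3δ.trans (min_le_left _ _)
  have h3δa : 3 * δ ≤ a ^ 2 := h3δ.trans ((min_le_right _ _).trans (min_le_left _ _))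
  have h3δη : 3 * δ ≤ η / (2 * (L * M + 1)) := h3δ.trans ((min_le_right _ _).trans (min_le_right _ _))
  -- `ρ` is bounded and integrable
  obtain ⟨Bρ, hBρ⟩ : ∃ B, ∀ t, |ρ t| ≤ B := by
    obtain ⟨B, hB⟩ := (isCompact_Icc (a := -(3 * δ)) (b := -δ)).exists_bound_of_continuousOn
      hρc.continuousOn
    refine ⟨max B 0, fun t => ?_⟩
    by_cases ht : t ∈ Icc (-(3 * δ)) (-δ)
    · exact (le_of_eq (Real.norm_eq_abs _).symm).trans ((hB t ht).trans (le_max_left _ _))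
    · rw [hρsupp t (fun h => ht (Ioo_subset_Icc_self h)), abs_zero]; exact le_max_right _ _
  have hρi : Integrable ρ := by
    refine hρc.integrable_of_hasCompactSupport ?_
    exact HasCompactSupport.intro (isCompact_Icc (a := -(3 * δ)) (b := -δ))
      fun t ht => hρsupp t (fun h => ht (Ioo_subset_Icc_self h))
  -- the pairing as an iterated integral
  have hUint := integrableOn_velocity hUm hE
  have hFint : IntegrableOn (fun z : ℝ × E => ρ z.1 * ⟪U z.1 z.2, ψ z.1 z.2⟫)
      (parabolicCylinder a ((0 : ℝ), x₀)) := by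
    refine (hUint.norm.const_mul (Bρ * Bψ)).mono' ?_ (Eventually.of_forall fun z => ?_)
    · exact ((hρc.comp continuous_fst).aestronglyMeasurable).mul
        (hUm.inner (hψ.contDiff.continuous.aestronglyMeasurable))
    · rw [Real.norm_eq_abs, abs_mul]
      calc |ρ z.1| * |⟪U z.1 z.2, ψ z.1 z.2⟫| ≤ Bρ * (‖U z.1 z.2‖ * ‖ψ z.1 z.2‖) :=
            mul_le_mul (hBρ _) (abs_real_inner_le_norm _ _) (abs_nonneg _)
              ((abs_nonneg _).trans (hBρ 0))
        _ ≤ Bρ * (‖U z.1 z.2‖ * Bψ) := by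
            gcongr
            · exact (abs_nonneg _).trans (hBρ 0)
            · exact hBψ' _ _
        _ = Bρ * Bψ * ‖uncurry U z‖ := by simp only [uncurry]; ring
  rw [setIntegral_cylinder_eq_iterated hFint]
  -- the inner integrals: `ρ(t) g(t)` with `|g(t)| ≤ η` near the top
  have hbound : ∀ᵐ t ∂(volume.restrict (Ioo (-a ^ 2) 0)),
      ‖∫ x in ball x₀ a, ρ t * ⟪U t x, ψ t x⟫‖ ≤ |ρ t| * η := by
    filter_upwards [hsl, ae_restrict_of_ae (s := Ioo (-a ^ 2) 0) hv] with t ht hvt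
    obtain ⟨hUt, hUt1⟩ := ht
    by_cases htρ : t ∈ Ioo (-(3 * δ)) (-δ)
    · have ht0 : t ∈ Ioo (-δ₁) 0 := ⟨by linarith [htρ.1], by linarith [htρ.2]⟩
      have hvt' := hvt ht0
      -- `g(t) = ∫_B ⟪U(t), ψ(0)⟫ + ∫_B ⟪U(t), ψ(t) - ψ(0)⟫`
      have hi0 : IntegrableOn (fun x => ⟪U t x, ψ 0 x⟫) (ball x₀ a) :=
        (hUt.norm.mul_const Bψ).mono' (hUt.aestronglyMeasurable.inner
          (hψ0.continuous.aestronglyMeasurable)) (Eventually.of_forall fun x =>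
            (abs_real_inner_le_norm _ _).trans (mul_le_mul_of_nonneg_left (hBψ' 0 x) (norm_nonneg _)))
      have hi1 : IntegrableOn (fun x => ⟪U t x, ψ t x - ψ 0 x⟫) (ball x₀ a) :=
        (hUt.norm.mul_const (Bψ + Bψ)).mono' (hUt.aestronglyMeasurable.inner
          (((hψ.contDiff_slice t).continuous.sub hψ0.continuous).aestronglyMeasurable))
          (Eventually.of_forall fun x => (abs_real_inner_le_norm _ _).trans
            (mul_le_mul_of_nonneg_left ((norm_sub_le _ _).trans (add_le_add (hBψ' t x) (hBψ' 0 x)))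
              (norm_nonneg _)))
      have hsplit : ∫ x in ball x₀ a, ⟪U t x, ψ t x⟫ =
          (∫ x in ball x₀ a, ⟪U t x, ψ 0 x⟫) + ∫ x in ball x₀ a, ⟪U t x, ψ t x - ψ 0 x⟫ := by
        rw [← integral_add hi0 hi1]
        refine integral_congr_ae (Eventually.of_forall fun x => ?_)
        show ⟪U t x, ψ t x⟫ = ⟪U t x, ψ 0 x⟫ + ⟪U t x, ψ t x - ψ 0 x⟫
        rw [← inner_add_right, add_sub_cancel]
      have hfirst : |∫ x in ball x₀ a, ⟪U t x, ψ 0 x⟫| ≤ η / 2 := by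
        rw [setIntegral_eq_integral_of_forall_compl_eq_zero fun x hx => by
          rw [image_eq_zero_of_notMem_tsupport fun h => hx (hψ0supp h), inner_zero_right]]
        exact hvt'
      have hsecond : |∫ x in ball x₀ a, ⟪U t x, ψ t x - ψ 0 x⟫| ≤ L * (3 * δ) * M := by
        have h1 : |∫ x in ball x₀ a, ⟪U t x, ψ t x - ψ 0 x⟫| ≤
            ∫ x in ball x₀ a, L * (3 * δ) * ‖U t x‖ := by
          rw [← Real.norm_eq_abs]
          refine norm_integral_le_of_norm_le (hUt.norm.const_mul _) (Eventually.of_forall fun x => ?_)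
          rw [Real.norm_eq_abs]
          calc |⟪U t x, ψ t x - ψ 0 x⟫| ≤ ‖U t x‖ * ‖ψ t x - ψ 0 x‖ := abs_real_inner_le_norm _ _
            _ ≤ ‖U t x‖ * (L * |t|) := mul_le_mul_of_nonneg_left (hLip t x) (norm_nonneg _)
            _ ≤ ‖U t x‖ * (L * (3 * δ)) := by
                refine mul_le_mul_of_nonneg_left (mul_le_mul_of_nonneg_left ?_ L.coe_nonneg)
                  (norm_nonneg _)
                rw [abs_le]; constructor <;> linarith [htρ.1, htρ.2]
            _ = L * (3 * δ) * ‖U t x‖ := by ring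
        rw [integral_const_mul] at h1
        exact h1.trans (mul_le_mul_of_nonneg_left hUt1 (by positivity))
      have hg : |∫ x in ball x₀ a, ⟪U t x, ψ t x⟫| ≤ η := by
        rw [hsplit]
        have hLM : L * (3 * δ) * M ≤ η / 2 := by
          have h1 : L * (3 * δ) * M ≤ L * (η / (2 * (L * M + 1))) * M :=
            mul_le_mul_of_nonneg_right (mul_le_mul_of_nonneg_left h3δη L.coe_nonneg) hM0
          have h2 : L * (η / (2 * (L * M + 1))) * M = (L * M) / (L * M + 1) * (η / 2) := by
            field_simp
          have h3 : (L * M) / (L * M + 1) ≤ 1 := by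
            rw [div_le_one (by positivity)]; linarith
          calc L * (3 * δ) * M ≤ (L * M) / (L * M + 1) * (η / 2) := by rw [← h2]; exact h1
            _ ≤ 1 * (η / 2) := mul_le_mul_of_nonneg_right h3 (by positivity)
            _ = η / 2 := one_mul _
        calc |(∫ x in ball x₀ a, ⟪U t x, ψ 0 x⟫) + ∫ x in ball x₀ a, ⟪U t x, ψ t x - ψ 0 x⟫|
            ≤ |∫ x in ball x₀ a, ⟪U t x, ψ 0 x⟫| + |∫ x in ball x₀ a, ⟪U t x, ψ t x - ψ 0 x⟫| :=
              abs_add_le _ _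
          _ ≤ η / 2 + η / 2 := add_le_add hfirst (hsecond.trans hLM)
          _ = η := by ring
      rw [integral_const_mul, norm_mul, Real.norm_eq_abs, Real.norm_eq_abs]
      exact mul_le_mul_of_nonneg_left hg (abs_nonneg _)
    · rw [hρsupp t htρ]
      simp
  -- sum up
  calc |∫ t in Ioo (-a ^ 2) 0, ∫ x in ball x₀ a, ρ t * ⟪U t x, ψ t x⟫|
      ≤ ∫ t in Ioo (-a ^ 2) 0, |ρ t| * η := by
        rw [← Real.norm_eq_abs]
        exact norm_integral_le_of_norm_le ((hρi.abs.mul_const η).integrableOn) hbound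
    _ ≤ ∫ t, |ρ t| * η := setIntegral_le_integral (hρi.abs.mul_const η)
        (Eventually.of_forall fun t => by positivity)
    _ = η := by rw [integral_mul_const, hρ1, one_mul]

end Pairing

/-! ### Exhaustion of the cylinder by time cut-offs -/

section Exhaustion

variable {a : ℝ} {x₀ : E}

/-- **Dominated convergence under the cut-offs.** If `θ_k ∈ [0, 1]` are continuous with
`θ_k = 1` on `(-∞, -3/(k+1)]`, then `∫_{Q_a} θ_k(t) f → ∫_{Q_a} f` for every `f ∈ L¹(Q_a)`. [folklore] -/
theorem tendsto_setIntegral_cutoff_mul {f : ℝ × E → ℝ}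
    (hf : IntegrableOn f (parabolicCylinder a ((0 : ℝ), x₀))) {θ : ℕ → ℝ → ℝ}
    (hθc : ∀ k, Continuous (θ k)) (hθ01 : ∀ k t, θ k t ∈ Icc (0 : ℝ) 1)
    (hθ1 : ∀ (k : ℕ) (t : ℝ), t ≤ -(3 * (1 / ((k : ℝ) + 1))) → θ k t = 1) :
    Tendsto (fun k => ∫ z in parabolicCylinder a ((0 : ℝ), x₀), θ k z.1 * f z) atTop
      (𝓝 (∫ z in parabolicCylinder a ((0 : ℝ), x₀), f z)) := by
  refine tendsto_integral_of_dominated_convergence (fun z => ‖f z‖)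
    (fun k => ((hθc k).comp continuous_fst).aestronglyMeasurable.mul hf.aestronglyMeasurable)
    hf.norm (fun k => Eventually.of_forall fun z => ?_) ?_
  · rw [norm_mul, Real.norm_eq_abs, abs_of_nonneg (hθ01 k z.1).1]
    exact mul_le_of_le_one_left (norm_nonneg _) (hθ01 k z.1).2
  · rw [parabolicCylinder_zero_eq]
    filter_upwards [ae_restrict_mem (measurableSet_Ioo.prod measurableSet_ball)] with z hz
    have hz0 : z.1 < 0 := hz.1.2
    -- eventually `θ_k(z.1) = 1`
    obtain ⟨N, hN⟩ := exists_nat_one_div_lt (by linarith : 0 < -z.1 / 3)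
    refine tendsto_atTop_of_eventually_const (i₀ := N) fun k hk => ?_
    rw [hθ1 k z.1 ?_, one_mul]
    have hk' : (1 : ℝ) / ((k : ℝ) + 1) ≤ 1 / ((N : ℝ) + 1) := by
      apply one_div_le_one_div_of_le (by positivity)
      exact_mod_cast Nat.succ_le_succ hk
    linarith

end Exhaustion

/-! ### Divergence and momentum equations up to the top, against tests on the box -/

section Equations

variable {a : ℝ} {x₀ : E} {U : ℝ → E → E} {P : ℝ → E → ℝ}

/-- **`div U = 0` on the cylinder against every scalar test function on the box.** [folklore] -/
theorem setIntegral_cylinder_inner_gradient_eq_zero (ha : 0 < a)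
    (hdist : IsDistributionalNSSolutionOn (parabolicCylinderOpens a ((0 : ℝ), x₀)) 1 0 U P)
    {C : ℝ≥0} (hE : ∀ᵐ t ∂(volume.restrict (Ioo (-a ^ 2) 0)), ∫⁻ x in ball x₀ a, ‖U t x‖ₑ ^ 2 ≤ C)
    {φ : ℝ → E → ℝ}
    (hφ : IsSpaceTimeTestOn ⟨Ioo (-a ^ 2) (a ^ 2) ×ˢ ball x₀ a, isOpen_box a x₀⟩ φ) :
    ∫ z in parabolicCylinder a ((0 : ℝ), x₀), ⟪U z.1 z.2, gradient (φ z.1) z.2⟫ = 0 := by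
  have hUm : AEStronglyMeasurable (uncurry U) (volume.restrict (parabolicCylinder a ((0 : ℝ), x₀))) := by
    have := hdist.1.aestronglyMeasurable; rwa [coe_parabolicCylinderOpens] at this
  have hUint := integrableOn_velocity hUm hE
  obtain ⟨Cφ, -, -, -, hgrad, -⟩ := hφ.exists_scalar_weights_bound
  -- the integrand is integrable on the cylinder
  set f : ℝ × E → ℝ := fun z => ⟪U z.1 z.2, gradient (φ z.1) z.2⟫ with hf
  have hfint : IntegrableOn f (parabolicCylinder a ((0 : ℝ), x₀)) := by
    refine (hUint.norm.mul_const Cφ).mono' (hUm.inner hφ.continuous_slice_gradient.aestronglyMeasurable)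
      (Eventually.of_forall fun z => ?_)
    exact (abs_real_inner_le_norm _ _).trans (mul_le_mul_of_nonneg_left (hgrad z) (norm_nonneg _))
  -- the cut-offs
  choose θ ρ hθs hθd hθ1 hθ0 hθ01 hρ0 hρsupp hρc hρi hρ1 using
    fun k : ℕ => exists_top_cutoff (one_div_pos.2 (Nat.cast_add_one_pos k) : (0 : ℝ) < 1 / ((k : ℝ) + 1))
  -- each cut-off identity: `∫ θ_k f = 0`
  have hk : ∀ k, ∫ z in parabolicCylinder a ((0 : ℝ), x₀), θ k z.1 * f z = 0 := by
    intro k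
    have htest := isSpaceTimeTestOn_cutoff_smul ha x₀ hφ (hθs k)
      (one_div_pos.2 (Nat.cast_add_one_pos k)) (hθ0 k)
    have h := hdist.2.2.2.1 _ htest
    rw [coe_parabolicCylinderOpens] at h
    refine Eq.trans (integral_congr_ae (Eventually.of_forall fun z => ?_)) h
    have hdiff : DifferentiableAt ℝ (φ z.1) z.2 :=
      ((hφ.contDiff_slice z.1).differentiable (by simp)).differentiableAt
    show θ k z.1 * ⟪U z.1 z.2, gradient (φ z.1) z.2⟫ = ⟪U z.1 z.2, gradient (fun x => θ k z.1 • φ z.1 x) z.2⟫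
    rw [gradient_fun_const_smul hdiff, real_inner_smul_right]
  have hlim := tendsto_setIntegral_cutoff_mul hfint (fun k => (hθs k).continuous) hθ01 hθ1
  simp_rw [hk] at hlim
  exact tendsto_nhds_unique hlim tendsto_const_nhds

/-- **The momentum equation on the cylinder against every test field on the box**, thanks to
the weak vanishing of `U(s)` as `s → 0⁻`. [folklore] -/
theorem setIntegral_cylinder_momentum_eq_zero (ha : 0 < a)
    (hdist : IsDistributionalNSSolutionOn (parabolicCylinderOpens a ((0 : ℝ), x₀)) 1 0 U P)
    {C : ℝ≥0} (hE : ∀ᵐ t ∂(volume.restrict (Ioo (-a ^ 2) 0)), ∫⁻ x in ball x₀ a, ‖U t x‖ₑ ^ 2 ≤ C)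
    (hP : MemLp (uncurry P) (3 / 2) (volume.restrict (parabolicCylinder a ((0 : ℝ), x₀))))
    (hvan : ∀ φ : E → E, ContDiff ℝ (⊤ : ℕ∞) φ → HasCompactSupport φ → tsupport φ ⊆ ball x₀ a →
      ∀ η > 0, ∃ δ > 0, ∀ᵐ s ∂(volume : Measure ℝ), s ∈ Ioo (-δ) 0 → |∫ x, ⟪U s x, φ x⟫| ≤ η)
    {ψ : ℝ → E → E}
    (hψ : IsSpaceTimeTestOn ⟨Ioo (-a ^ 2) (a ^ 2) ×ˢ ball x₀ a, isOpen_box a x₀⟩ ψ) :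
    ∫ z in parabolicCylinder a ((0 : ℝ), x₀),
      (⟪U z.1 z.2, timeDeriv ψ z.1 z.2⟫ + ⟪U z.1 z.2, convect (U z.1) (ψ z.1) z.2⟫ +
        1 * ⟪U z.1 z.2, Δ (ψ z.1) z.2⟫ +
        P z.1 z.2 * VectorCalculus.divergence (ψ z.1) z.2) = 0 := by
  have hUm : AEStronglyMeasurable (uncurry U) (volume.restrict (parabolicCylinder a ((0 : ℝ), x₀))) := by
    have := hdist.1.aestronglyMeasurable; rwa [coe_parabolicCylinderOpens] at this
  have hUint := integrableOn_velocity hUm hE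
  have hU2 := integrableOn_norm_sq hUm hE
  obtain ⟨hPint, -⟩ := integrableOn_pressure hP
  obtain ⟨Cψ, hC0, hdt, hfd, hlap, hdiv⟩ := hψ.exists_weights_bound
  -- the integrand `I` is integrable on the cylinder
  set I : ℝ × E → ℝ := fun z => ⟪U z.1 z.2, timeDeriv ψ z.1 z.2⟫ +
      ⟪U z.1 z.2, convect (U z.1) (ψ z.1) z.2⟫ + 1 * ⟪U z.1 z.2, Δ (ψ z.1) z.2⟫ +
      P z.1 z.2 * VectorCalculus.divergence (ψ z.1) z.2 with hI
  have hconv_m : AEStronglyMeasurable (fun z : ℝ × E => convect (U z.1) (ψ z.1) z.2)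
      (volume.restrict (parabolicCylinder a ((0 : ℝ), x₀))) := by
    have hΦ : Continuous fun q : (ℝ × E) × E => fderiv ℝ (ψ q.1.1) q.1.2 q.2 :=
      (hψ.continuous_fderiv_slice.comp continuous_fst).clm_apply continuous_snd
    exact hΦ.comp_aestronglyMeasurable (aestronglyMeasurable_id.prodMk hUm)
  have hIm : AEStronglyMeasurable I (volume.restrict (parabolicCylinder a ((0 : ℝ), x₀))) := by
    refine (((hUm.inner hψ.continuous_timeDeriv.aestronglyMeasurable).add (hUm.inner hconv_m)).add
      ((hUm.inner hψ.continuous_laplacian_slice.aestronglyMeasurable).const_mul 1)).add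
      (hP.aestronglyMeasurable.mul hψ.continuous_divergence_slice.aestronglyMeasurable)
  have hIint : IntegrableOn I (parabolicCylinder a ((0 : ℝ), x₀)) := by
    refine ((((hUint.norm.mul_const Cψ).add (hU2.mul_const Cψ)).add (hUint.norm.mul_const Cψ)).add
      (hPint.norm.mul_const Cψ)).mono' hIm (Eventually.of_forall fun z => ?_)
    have h1 : |⟪U z.1 z.2, timeDeriv ψ z.1 z.2⟫| ≤ ‖uncurry U z‖ * Cψ :=
      (abs_real_inner_le_norm _ _).trans (mul_le_mul_of_nonneg_left (hdt z) (norm_nonneg _))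
    have h2 : |⟪U z.1 z.2, convect (U z.1) (ψ z.1) z.2⟫| ≤ ‖U z.1 z.2‖ ^ 2 * Cψ := by
      refine (abs_real_inner_le_norm _ _).trans ?_
      rw [convect]
      calc ‖U z.1 z.2‖ * ‖fderiv ℝ (ψ z.1) z.2 (U z.1 z.2)‖
          ≤ ‖U z.1 z.2‖ * (‖fderiv ℝ (ψ z.1) z.2‖ * ‖U z.1 z.2‖) :=
            mul_le_mul_of_nonneg_left (ContinuousLinearMap.le_opNorm _ _) (norm_nonneg _)
        _ ≤ ‖U z.1 z.2‖ * (Cψ * ‖U z.1 z.2‖) := by gcongr; exact hfd z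
        _ = ‖U z.1 z.2‖ ^ 2 * Cψ := by ring
    have h3 : |1 * ⟪U z.1 z.2, Δ (ψ z.1) z.2⟫| ≤ ‖uncurry U z‖ * Cψ := by
      rw [one_mul]
      exact (abs_real_inner_le_norm _ _).trans (mul_le_mul_of_nonneg_left (hlap z) (norm_nonneg _))
    have h4 : |P z.1 z.2 * VectorCalculus.divergence (ψ z.1) z.2| ≤ ‖uncurry P z‖ * Cψ := by
      rw [abs_mul]
      exact mul_le_mul_of_nonneg_left (le_trans (le_of_eq (Real.norm_eq_abs _).symm) (hdiv z))
        (abs_nonneg _)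
    rw [Real.norm_eq_abs]
    calc |I z| ≤ |⟪U z.1 z.2, timeDeriv ψ z.1 z.2⟫ + ⟪U z.1 z.2, convect (U z.1) (ψ z.1) z.2⟫ +
          1 * ⟪U z.1 z.2, Δ (ψ z.1) z.2⟫| + |P z.1 z.2 * VectorCalculus.divergence (ψ z.1) z.2| :=
          abs_add_le _ _
      _ ≤ (|⟪U z.1 z.2, timeDeriv ψ z.1 z.2⟫ + ⟪U z.1 z.2, convect (U z.1) (ψ z.1) z.2⟫| +
          |1 * ⟪U z.1 z.2, Δ (ψ z.1) z.2⟫|) + |P z.1 z.2 * VectorCalculus.divergence (ψ z.1) z.2| := by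
          gcongr; exact abs_add_le _ _
      _ ≤ ((|⟪U z.1 z.2, timeDeriv ψ z.1 z.2⟫| + |⟪U z.1 z.2, convect (U z.1) (ψ z.1) z.2⟫|) +
          |1 * ⟪U z.1 z.2, Δ (ψ z.1) z.2⟫|) + |P z.1 z.2 * VectorCalculus.divergence (ψ z.1) z.2| := by
          gcongr; exact abs_add_le _ _
      _ ≤ ((‖uncurry U z‖ * Cψ + ‖U z.1 z.2‖ ^ 2 * Cψ) + ‖uncurry U z‖ * Cψ) + ‖uncurry P z‖ * Cψ := by
          gcongr
  -- the cut-offs and the smallness of the pairing term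
  choose θ ρ hθs hθd hθ1 hθ0 hθ01 hρ0 hρsupp hρc hρi hρ1 using
    fun k : ℕ => exists_top_cutoff (one_div_pos.2 (Nat.cast_add_one_pos k) : (0 : ℝ) < 1 / ((k : ℝ) + 1))
  -- the pairing integrand
  obtain ⟨Bψ, hBψ⟩ := hψ.hasCompactSupport.exists_bound_of_continuous hψ.contDiff.continuous
  have hgint : ∀ k, IntegrableOn (fun z : ℝ × E => ρ k z.1 * ⟪U z.1 z.2, ψ z.1 z.2⟫)
      (parabolicCylinder a ((0 : ℝ), x₀)) := by
    intro k
    obtain ⟨Bρ, hBρ⟩ : ∃ B, ∀ t, |ρ k t| ≤ B := by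
      obtain ⟨B, hB⟩ := (isCompact_Icc (a := -(3 * (1 / ((k : ℝ) + 1)))) (b := -(1 / ((k : ℝ) + 1)))).exists_bound_of_continuousOn
        (hρc k).continuousOn
      refine ⟨max B 0, fun t => ?_⟩
      by_cases ht : t ∈ Icc (-(3 * (1 / ((k : ℝ) + 1)))) (-(1 / ((k : ℝ) + 1)))
      · exact (le_of_eq (Real.norm_eq_abs _).symm).trans ((hB t ht).trans (le_max_left _ _))
      · rw [hρsupp k t (fun h => ht (Ioo_subset_Icc_self h)), abs_zero]; exact le_max_right _ _
    refine (hUint.norm.const_mul (Bρ * Bψ)).mono' ?_ (Eventually.of_forall fun z => ?_)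
    · exact (((hρc k).comp continuous_fst).aestronglyMeasurable).mul
        (hUm.inner (hψ.contDiff.continuous.aestronglyMeasurable))
    · rw [Real.norm_eq_abs, abs_mul]
      calc |ρ k z.1| * |⟪U z.1 z.2, ψ z.1 z.2⟫| ≤ Bρ * (‖U z.1 z.2‖ * ‖ψ z.1 z.2‖) :=
            mul_le_mul (hBρ _) (abs_real_inner_le_norm _ _) (abs_nonneg _)
              ((abs_nonneg _).trans (hBρ 0))
        _ ≤ Bρ * (‖U z.1 z.2‖ * Bψ) := by
            gcongr
            · exact (abs_nonneg _).trans (hBρ 0)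
            · exact hBψ (z.1, z.2)
        _ = Bρ * Bψ * ‖uncurry U z‖ := by simp only [uncurry]; ring
  -- each cut-off identity: `∫ ρ_k ⟪U, ψ⟫ + ∫ θ_k I = 0`
  have hθI : ∀ k, IntegrableOn (fun z : ℝ × E => θ k z.1 * I z) (parabolicCylinder a ((0 : ℝ), x₀)) :=
    fun k => hIint.norm.mono' ((((hθs k).continuous.comp continuous_fst).aestronglyMeasurable).mul hIm)
      (Eventually.of_forall fun z => by
        rw [norm_mul, Real.norm_eq_abs, abs_of_nonneg (hθ01 k z.1).1]
        exact mul_le_of_le_one_left (norm_nonneg _) (hθ01 k z.1).2)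
  have hk : ∀ k, (∫ z in parabolicCylinder a ((0 : ℝ), x₀), ρ k z.1 * ⟪U z.1 z.2, ψ z.1 z.2⟫) +
      ∫ z in parabolicCylinder a ((0 : ℝ), x₀), θ k z.1 * I z = 0 := by
    intro k
    have htest := isSpaceTimeTestOn_cutoff_smul ha x₀ hψ (hθs k)
      (one_div_pos.2 (Nat.cast_add_one_pos k)) (hθ0 k)
    have h := hdist.2.2.2.2 _ htest
    rw [coe_parabolicCylinderOpens] at h
    calc (∫ z in parabolicCylinder a ((0 : ℝ), x₀), ρ k z.1 * ⟪U z.1 z.2, ψ z.1 z.2⟫) +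
          ∫ z in parabolicCylinder a ((0 : ℝ), x₀), θ k z.1 * I z
        = ∫ z in parabolicCylinder a ((0 : ℝ), x₀), (ρ k z.1 * ⟪U z.1 z.2, ψ z.1 z.2⟫ + θ k z.1 * I z) :=
          (integral_add (hgint k) (hθI k)).symm
      _ = _ := integral_congr_ae (Eventually.of_forall fun z => ?_)
      _ = 0 := h
    have hdiff : DifferentiableAt ℝ (ψ z.1) z.2 :=
      ((hψ.contDiff_slice z.1).differentiable (by simp)).differentiableAt
    have ht : timeDeriv (fun t x => θ k t • ψ t x) z.1 z.2 =
        ρ k z.1 • ψ z.1 z.2 + θ k z.1 • timeDeriv ψ z.1 z.2 :=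
      timeDeriv_cutoff (hθd k) hψ.hasDerivAt_time z.1 z.2
    have hc : convect (U z.1) (fun x => θ k z.1 • ψ z.1 x) z.2 = θ k z.1 • convect (U z.1) (ψ z.1) z.2 := by
      simp only [convect]
      rw [fderiv_fun_const_smul hdiff, FunLike.coe_smul, Pi.smul_apply]
    have hl : Δ (fun x => θ k z.1 • ψ z.1 x) z.2 = θ k z.1 • Δ (ψ z.1) z.2 :=
      laplacian_fun_const_smul (contDiff_infty.1 (hψ.contDiff_slice z.1) 2) (θ k z.1) z.2
    have hd : VectorCalculus.divergence (fun x => θ k z.1 • ψ z.1 x) z.2 =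
        θ k z.1 * VectorCalculus.divergence (ψ z.1) z.2 :=
      divergence_const_smul_apply hdiff _
    show ρ k z.1 * ⟪U z.1 z.2, ψ z.1 z.2⟫ + θ k z.1 * I z =
      ⟪U z.1 z.2, timeDeriv (fun t x => θ k t • ψ t x) z.1 z.2⟫ +
        ⟪U z.1 z.2, convect (U z.1) (fun x => θ k z.1 • ψ z.1 x) z.2⟫ +
        1 * ⟪U z.1 z.2, Δ (fun x => θ k z.1 • ψ z.1 x) z.2⟫ +
        P z.1 z.2 * VectorCalculus.divergence (fun x => θ k z.1 • ψ z.1 x) z.2 +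
        ⟪(0 : ℝ → E → E) z.1 z.2, θ k z.1 • ψ z.1 z.2⟫
    rw [ht, hc, hl, hd, inner_add_right, real_inner_smul_right, real_inner_smul_right,
      real_inner_smul_right, real_inner_smul_right]
    simp only [Pi.zero_apply, inner_zero_left, add_zero, hI]
    ring
  -- conclusion: `∫ θ_k I → ∫ I` and `∫ θ_k I → 0`
  have hlim := tendsto_setIntegral_cutoff_mul hIint (fun k => (hθs k).continuous) hθ01 hθ1
  have hzero : Tendsto (fun k => ∫ z in parabolicCylinder a ((0 : ℝ), x₀), θ k z.1 * I z) atTop (𝓝 0) := by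
    rw [Metric.tendsto_atTop]
    intro η hη
    obtain ⟨δ₀, hδ₀, hsmall⟩ := abs_setIntegral_cutoff_pairing_le ha hUm hE hvan hψ (half_pos hη)
    obtain ⟨N, hN⟩ := exists_nat_one_div_lt (by positivity : 0 < δ₀ / 3)
    refine ⟨N, fun k hk' => ?_⟩
    have hkδ : 3 * (1 / ((k : ℝ) + 1)) ≤ δ₀ := by
      have : (1 : ℝ) / ((k : ℝ) + 1) ≤ 1 / ((N : ℝ) + 1) := by
        apply one_div_le_one_div_of_le (by positivity)
        exact_mod_cast Nat.succ_le_succ hk'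
      linarith
    have hb := hsmall (one_div_pos.2 (Nat.cast_add_one_pos k)) hkδ (hρc k) (hρsupp k) (hρ1 k)
    have he : ∫ z in parabolicCylinder a ((0 : ℝ), x₀), θ k z.1 * I z =
        -∫ z in parabolicCylinder a ((0 : ℝ), x₀), ρ k z.1 * ⟪U z.1 z.2, ψ z.1 z.2⟫ := by
      linarith [hk k]
    rw [Real.dist_eq, sub_zero, he, abs_neg]
    linarith
  have := tendsto_nhds_unique hlim hzero
  exact this

end Equations

/-! ### The weak spatial gradient up to the top -/

section Gradient

variable {a : ℝ} {x₀ : E} {U : ℝ → E → E} {G : ℝ → E → E →L[ℝ] E}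

/-- `∇U ∈ L²(Q_a)` gives `∇U ∈ L¹(Q_a)` (operator norm below the Frobenius norm). [folklore] -/
theorem integrableOn_grad (hG : HasWeakSpatialGradientOn (parabolicCylinderOpens a ((0 : ℝ), x₀)) U G)
    (hGfin : ∫⁻ z in parabolicCylinder a ((0 : ℝ), x₀),
      ENNReal.ofReal (frobeniusNormSq (G z.1 z.2)) < ⊤) :
    IntegrableOn (uncurry G) (parabolicCylinder a ((0 : ℝ), x₀)) ∧
      IntegrableOn (fun z : ℝ × E => frobeniusNormSq (G z.1 z.2)) (parabolicCylinder a ((0 : ℝ), x₀)) := by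
  have hGm : AEStronglyMeasurable (uncurry G) (volume.restrict (parabolicCylinder a ((0 : ℝ), x₀))) := by
    have := hG.locallyIntegrableOn_grad.aestronglyMeasurable; rwa [coe_parabolicCylinderOpens] at this
  have hfin : volume (parabolicCylinder a ((0 : ℝ), x₀)) < ⊤ := by
    rw [parabolicCylinder_zero_eq]
    exact ((isCompact_Icc.prod (isCompact_closedBall x₀ a)).measure_lt_top).trans_le'
      (measure_mono (prod_mono Ioo_subset_Icc_self ball_subset_closedBall))
  -- `frobeniusNormSq ∘ G` is integrable
  have hFm : AEStronglyMeasurable (fun z : ℝ × E => frobeniusNormSq (G z.1 z.2))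
      (volume.restrict (parabolicCylinder a ((0 : ℝ), x₀))) := by
    have hc : Continuous fun L : E →L[ℝ] E => frobeniusNormSq L := by
      unfold frobeniusNormSq; fun_prop
    exact hc.comp_aestronglyMeasurable hGm
  have hF : IntegrableOn (fun z : ℝ × E => frobeniusNormSq (G z.1 z.2)) (parabolicCylinder a ((0 : ℝ), x₀)) := by
    refine ⟨hFm, ?_⟩
    rw [hasFiniteIntegral_iff_enorm]
    refine lt_of_le_of_lt (lintegral_congr_ae (Eventually.of_forall fun z => ?_)).le hGfin
    rw [Real.enorm_eq_ofReal (frobeniusNormSq_nonneg _)]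
  refine ⟨((integrableOn_const (C := (1 : ℝ)) hfin.ne).add hF).mono' hGm
    (Eventually.of_forall fun z => ?_), hF⟩
  show ‖G z.1 z.2‖ ≤ 1 + frobeniusNormSq (G z.1 z.2)
  nlinarith [sq_opNorm_le_frobeniusNormSq (G z.1 z.2), norm_nonneg (G z.1 z.2),
    sq_nonneg (‖G z.1 z.2‖ - 1)]

/-- Integrability of `∂ᵥφ ⟪U, w⟫` on the cylinder for a scalar test `φ` on the box. [folklore] -/
theorem integrableOn_fderiv_mul_inner
    (hUm : AEStronglyMeasurable (uncurry U) (volume.restrict (parabolicCylinder a ((0 : ℝ), x₀))))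
    {C : ℝ≥0} (hE : ∀ᵐ t ∂(volume.restrict (Ioo (-a ^ 2) 0)), ∫⁻ x in ball x₀ a, ‖U t x‖ₑ ^ 2 ≤ C)
    {φ : ℝ → E → ℝ}
    (hφ : IsSpaceTimeTestOn ⟨Ioo (-a ^ 2) (a ^ 2) ×ˢ ball x₀ a, isOpen_box a x₀⟩ φ) (v w : E) :
    IntegrableOn (fun z : ℝ × E => fderiv ℝ (φ z.1) z.2 v * ⟪U z.1 z.2, w⟫)
      (parabolicCylinder a ((0 : ℝ), x₀)) := by
  have hUint := integrableOn_velocity hUm hE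
  obtain ⟨Cφ, hC0, -, -, hgrad, -⟩ := hφ.exists_scalar_weights_bound
  have hfdb : ∀ z : ℝ × E, ‖fderiv ℝ (φ z.1) z.2 v‖ ≤ Cφ * ‖v‖ := fun z => by
    have hn : ‖gradient (φ z.1) z.2‖ = ‖fderiv ℝ (φ z.1) z.2‖ := by
      rw [gradient, LinearIsometryEquiv.norm_map]
    calc ‖fderiv ℝ (φ z.1) z.2 v‖ ≤ ‖fderiv ℝ (φ z.1) z.2‖ * ‖v‖ := ContinuousLinearMap.le_opNorm _ _
      _ ≤ Cφ * ‖v‖ := by rw [← hn]; exact mul_le_mul_of_nonneg_right (hgrad z) (norm_nonneg _)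
  refine (hUint.norm.const_mul (Cφ * ‖v‖ * ‖w‖)).mono'
    (((hφ.continuous_fderiv_slice.clm_apply continuous_const).aestronglyMeasurable).mul
      (hUm.inner aestronglyMeasurable_const)) (Eventually.of_forall fun z => ?_)
  rw [norm_mul]
  calc ‖fderiv ℝ (φ z.1) z.2 v‖ * ‖⟪U z.1 z.2, w⟫‖ ≤ (Cφ * ‖v‖) * (‖U z.1 z.2‖ * ‖w‖) :=
        mul_le_mul (hfdb z) (norm_inner_le_norm _ _) (norm_nonneg _) (by positivity)
    _ = Cφ * ‖v‖ * ‖w‖ * ‖uncurry U z‖ := by simp only [uncurry]; ring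

/-- Integrability of `φ ⟪∇U v, w⟫` on the cylinder for a scalar test `φ` on the box. [folklore] -/
theorem integrableOn_mul_inner_grad
    (hG : HasWeakSpatialGradientOn (parabolicCylinderOpens a ((0 : ℝ), x₀)) U G)
    (hGfin : ∫⁻ z in parabolicCylinder a ((0 : ℝ), x₀),
      ENNReal.ofReal (frobeniusNormSq (G z.1 z.2)) < ⊤)
    {φ : ℝ → E → ℝ}
    (hφ : IsSpaceTimeTestOn ⟨Ioo (-a ^ 2) (a ^ 2) ×ˢ ball x₀ a, isOpen_box a x₀⟩ φ) (v w : E) :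
    IntegrableOn (fun z : ℝ × E => φ z.1 z.2 * ⟪G z.1 z.2 v, w⟫)
      (parabolicCylinder a ((0 : ℝ), x₀)) := by
  obtain ⟨hGint, -⟩ := integrableOn_grad hG hGfin
  obtain ⟨Cφ, hC0, hφb, -, -, -⟩ := hφ.exists_scalar_weights_bound
  have hGm : AEStronglyMeasurable (uncurry G) (volume.restrict (parabolicCylinder a ((0 : ℝ), x₀))) :=
    hGint.aestronglyMeasurable
  have hGvm : AEStronglyMeasurable (fun z : ℝ × E => G z.1 z.2 v)
      (volume.restrict (parabolicCylinder a ((0 : ℝ), x₀))) :=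
    (ContinuousLinearMap.apply ℝ E v).continuous.comp_aestronglyMeasurable hGm
  refine (hGint.norm.const_mul (Cφ * ‖v‖ * ‖w‖)).mono'
    ((hφ.contDiff.continuous.aestronglyMeasurable).mul (hGvm.inner aestronglyMeasurable_const))
    (Eventually.of_forall fun z => ?_)
  rw [norm_mul]
  calc ‖φ z.1 z.2‖ * ‖⟪G z.1 z.2 v, w⟫‖ ≤ Cφ * (‖G z.1 z.2 v‖ * ‖w‖) :=
        mul_le_mul (hφb z) (norm_inner_le_norm _ _) (norm_nonneg _) (by positivity)
    _ ≤ Cφ * ((‖G z.1 z.2‖ * ‖v‖) * ‖w‖) := by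
        gcongr; exact ContinuousLinearMap.le_opNorm _ _
    _ = Cφ * ‖v‖ * ‖w‖ * ‖uncurry G z‖ := by simp only [uncurry]; ring

/-- **The weak spatial gradient identity on the cylinder against tests on the box.** [folklore] -/
theorem setIntegral_cylinder_fderiv_mul_inner_eq (ha : 0 < a)
    (hG : HasWeakSpatialGradientOn (parabolicCylinderOpens a ((0 : ℝ), x₀)) U G)
    (hGfin : ∫⁻ z in parabolicCylinder a ((0 : ℝ), x₀),
      ENNReal.ofReal (frobeniusNormSq (G z.1 z.2)) < ⊤)
    {C : ℝ≥0} (hE : ∀ᵐ t ∂(volume.restrict (Ioo (-a ^ 2) 0)), ∫⁻ x in ball x₀ a, ‖U t x‖ₑ ^ 2 ≤ C)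
    {φ : ℝ → E → ℝ}
    (hφ : IsSpaceTimeTestOn ⟨Ioo (-a ^ 2) (a ^ 2) ×ˢ ball x₀ a, isOpen_box a x₀⟩ φ) (v w : E) :
    ∫ z in parabolicCylinder a ((0 : ℝ), x₀), fderiv ℝ (φ z.1) z.2 v * ⟪U z.1 z.2, w⟫ =
      -∫ z in parabolicCylinder a ((0 : ℝ), x₀), φ z.1 z.2 * ⟪G z.1 z.2 v, w⟫ := by
  have hUm : AEStronglyMeasurable (uncurry U) (volume.restrict (parabolicCylinder a ((0 : ℝ), x₀))) := by
    have := hG.locallyIntegrableOn.aestronglyMeasurable; rwa [coe_parabolicCylinderOpens] at this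
  have hLint := integrableOn_fderiv_mul_inner hUm hE hφ v w
  have hRint := integrableOn_mul_inner_grad hG hGfin hφ v w
  -- the cut-offs
  choose θ ρ hθs hθd hθ1 hθ0 hθ01 hρ0 hρsupp hρc hρi hρ1 using
    fun k : ℕ => exists_top_cutoff (one_div_pos.2 (Nat.cast_add_one_pos k) : (0 : ℝ) < 1 / ((k : ℝ) + 1))
  have hk : ∀ k, ∫ z in parabolicCylinder a ((0 : ℝ), x₀), θ k z.1 * (fderiv ℝ (φ z.1) z.2 v * ⟪U z.1 z.2, w⟫) =
      -∫ z in parabolicCylinder a ((0 : ℝ), x₀), θ k z.1 * (φ z.1 z.2 * ⟪G z.1 z.2 v, w⟫) := by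
    intro k
    have htest := isSpaceTimeTestOn_cutoff_smul ha x₀ hφ (hθs k)
      (one_div_pos.2 (Nat.cast_add_one_pos k)) (hθ0 k)
    have h := hG.integral_fderiv_mul_inner_eq _ htest v w
    -- both iterated integrals are set integrals over the cylinder
    have hsub : tsupport (uncurry fun t x => θ k t • φ t x) ⊆ parabolicCylinder a ((0 : ℝ), x₀) := by
      have := htest.tsupport_subset; rwa [coe_parabolicCylinderOpens] at this
    have hL0 : ∀ z, z ∉ parabolicCylinder a ((0 : ℝ), x₀) →
        fderiv ℝ (fun x => θ k z.1 • φ z.1 x) z.2 v * ⟪U z.1 z.2, w⟫ = 0 := by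
      intro z hz
      have : fderiv ℝ ((fun t x => θ k t • φ t x) z.1) z.2 = 0 :=
        htest.fderiv_slice_eq_zero (by rwa [coe_parabolicCylinderOpens])
      show fderiv ℝ ((fun t x => θ k t • φ t x) z.1) z.2 v * ⟪U z.1 z.2, w⟫ = 0
      rw [this]; simp
    have hR0 : ∀ z, z ∉ parabolicCylinder a ((0 : ℝ), x₀) →
        θ k z.1 • φ z.1 z.2 * ⟪G z.1 z.2 v, w⟫ = 0 := by
      intro z hz
      have : (fun t x => θ k t • φ t x) z.1 z.2 = 0 := htest.apply_eq_zero (by rwa [coe_parabolicCylinderOpens])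
      show (fun t x => θ k t • φ t x) z.1 z.2 * ⟪G z.1 z.2 v, w⟫ = 0
      rw [this, zero_mul]
    have hdiff : ∀ z : ℝ × E, DifferentiableAt ℝ (φ z.1) z.2 := fun z =>
      ((hφ.contDiff_slice z.1).differentiable (by simp)).differentiableAt
    have eL : ∀ z : ℝ × E, fderiv ℝ (fun x => θ k z.1 • φ z.1 x) z.2 v * ⟪U z.1 z.2, w⟫ =
        θ k z.1 * (fderiv ℝ (φ z.1) z.2 v * ⟪U z.1 z.2, w⟫) := fun z => by
      rw [fderiv_fun_const_smul (hdiff z), FunLike.coe_smul, Pi.smul_apply, smul_eq_mul, mul_assoc]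
    have eR : ∀ z : ℝ × E, θ k z.1 • φ z.1 z.2 * ⟪G z.1 z.2 v, w⟫ =
        θ k z.1 * (φ z.1 z.2 * ⟪G z.1 z.2 v, w⟫) := fun z => by rw [smul_eq_mul, mul_assoc]
    have hθL : IntegrableOn (fun z : ℝ × E => θ k z.1 * (fderiv ℝ (φ z.1) z.2 v * ⟪U z.1 z.2, w⟫))
        (parabolicCylinder a ((0 : ℝ), x₀)) :=
      hLint.norm.mono' ((((hθs k).continuous.comp continuous_fst).aestronglyMeasurable).mul
        hLint.aestronglyMeasurable) (Eventually.of_forall fun z => by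
          rw [norm_mul, Real.norm_eq_abs, abs_of_nonneg (hθ01 k z.1).1]
          exact mul_le_of_le_one_left (norm_nonneg _) (hθ01 k z.1).2)
    have hθR : IntegrableOn (fun z : ℝ × E => θ k z.1 * (φ z.1 z.2 * ⟪G z.1 z.2 v, w⟫))
        (parabolicCylinder a ((0 : ℝ), x₀)) :=
      hRint.norm.mono' ((((hθs k).continuous.comp continuous_fst).aestronglyMeasurable).mul
        hRint.aestronglyMeasurable) (Eventually.of_forall fun z => by
          rw [norm_mul, Real.norm_eq_abs, abs_of_nonneg (hθ01 k z.1).1]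
          exact mul_le_of_le_one_left (norm_nonneg _) (hθ01 k z.1).2)
    have hL := integral_integral_eq_setIntegral (S := parabolicCylinder a ((0 : ℝ), x₀))
      (H := fun z : ℝ × E => fderiv ℝ (fun x => θ k z.1 • φ z.1 x) z.2 v * ⟪U z.1 z.2, w⟫)
      (by simp_rw [eL]; exact hθL) hL0
    have hR := integral_integral_eq_setIntegral (S := parabolicCylinder a ((0 : ℝ), x₀))
      (H := fun z : ℝ × E => θ k z.1 • φ z.1 z.2 * ⟪G z.1 z.2 v, w⟫)
      (by simp_rw [eR]; exact hθR) hR0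
    simp only at hL hR
    rw [hL, hR] at h
    simp_rw [eL, eR] at h
    exact h
  have hlimL := tendsto_setIntegral_cutoff_mul hLint (fun k => (hθs k).continuous) hθ01 hθ1
  have hlimR := (tendsto_setIntegral_cutoff_mul hRint (fun k => (hθs k).continuous) hθ01 hθ1).neg
  simp_rw [hk] at hlimL
  exact tendsto_nhds_unique hlimL hlimR

end Gradient

/-! ### The local energy inequality up to the top -/

section Energy

variable {a : ℝ} {x₀ : E} {U : ℝ → E → E} {P : ℝ → E → ℝ} {G : ℝ → E → E →L[ℝ] E}

omit [InnerProductSpace ℝ E] [FiniteDimensional ℝ E] [MeasurableSpace E] [BorelSpace E] in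
/-- Off the cylinder but below the final time, nothing of the box remains. [folklore] -/
theorem notMem_box_of_neg_of_notMem_cylinder (ha : 0 < a) {z : ℝ × E} (hz : z.1 < 0)
    (hzQ : z ∉ parabolicCylinder a ((0 : ℝ), x₀)) : z ∉ (Ioo (-a ^ 2) (a ^ 2) ×ˢ ball x₀ a) :=
  fun hzb => hzQ (by rw [← box_inter_neg_eq ha]; exact ⟨hzb, hz⟩)

omit [MeasurableSpace E] [BorelSpace E] in
/-- The right-hand integrand of the local energy inequality of a test on the box vanishes below
the final time off the cylinder. [folklore] -/
theorem localEnergyRHS_eq_zero_of_neg_of_notMem (ha : 0 < a) {V : ℝ → E → E} {Pr : ℝ → E → ℝ}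
    {φ : ℝ → E → ℝ}
    (hφ : IsSpaceTimeTestOn ⟨Ioo (-a ^ 2) (a ^ 2) ×ˢ ball x₀ a, isOpen_box a x₀⟩ φ)
    {z : ℝ × E} (hz : z.1 < 0) (hzQ : z ∉ parabolicCylinder a ((0 : ℝ), x₀)) :
    localEnergyRHS 1 0 V Pr φ z = 0 := by
  have h0 := notMem_box_of_neg_of_notMem_cylinder ha hz hzQ
  have e1 : timeDeriv φ z.1 z.2 = 0 := hφ.timeDeriv_eq_zero h0
  have e2 : Δ (φ z.1) z.2 = 0 := hφ.laplacian_slice_eq_zero h0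
  have e3 : gradient (φ z.1) z.2 = 0 := by
    rw [gradient, hφ.fderiv_slice_eq_zero h0, map_zero]
  have e4 : φ z.1 z.2 = 0 := hφ.apply_eq_zero h0
  simp only [localEnergyRHS, e1, e2, e3, e4, inner_zero_right, mul_zero, add_zero]

/-- Integrability of `|∇U|² φ` on the cylinder. [folklore] -/
theorem integrableOn_frob_mul
    (hG : HasWeakSpatialGradientOn (parabolicCylinderOpens a ((0 : ℝ), x₀)) U G)
    (hGfin : ∫⁻ z in parabolicCylinder a ((0 : ℝ), x₀),
      ENNReal.ofReal (frobeniusNormSq (G z.1 z.2)) < ⊤)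
    {φ : ℝ → E → ℝ}
    (hφ : IsSpaceTimeTestOn ⟨Ioo (-a ^ 2) (a ^ 2) ×ˢ ball x₀ a, isOpen_box a x₀⟩ φ) :
    IntegrableOn (fun z : ℝ × E => frobeniusNormSq (G z.1 z.2) * φ z.1 z.2)
      (parabolicCylinder a ((0 : ℝ), x₀)) := by
  obtain ⟨-, hF⟩ := integrableOn_grad hG hGfin
  obtain ⟨Cφ, -, hφb, -, -, -⟩ := hφ.exists_scalar_weights_bound
  exact (hF.mul_const Cφ).mono' (hF.aestronglyMeasurable.mul hφ.contDiff.continuous.aestronglyMeasurable)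
    (Eventually.of_forall fun z => by
      rw [Real.norm_eq_abs, abs_mul, abs_of_nonneg (frobeniusNormSq_nonneg _)]
      exact mul_le_mul_of_nonneg_left ((le_of_eq (Real.norm_eq_abs _).symm).trans (hφb z))
        (frobeniusNormSq_nonneg _))

/-- Integrability of the right-hand integrand of the local energy inequality on the cylinder
(classes up to the top). [folklore] -/
theorem integrableOn_localEnergyRHS
    (hUm : AEStronglyMeasurable (uncurry U) (volume.restrict (parabolicCylinder a ((0 : ℝ), x₀))))
    {C : ℝ≥0} (hE : ∀ᵐ t ∂(volume.restrict (Ioo (-a ^ 2) 0)), ∫⁻ x in ball x₀ a, ‖U t x‖ₑ ^ 2 ≤ C)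
    (hU3 : MemLp (uncurry U) 3 (volume.restrict (parabolicCylinder a ((0 : ℝ), x₀))))
    (hP : MemLp (uncurry P) (3 / 2) (volume.restrict (parabolicCylinder a ((0 : ℝ), x₀))))
    {φ : ℝ → E → ℝ}
    (hφ : IsSpaceTimeTestOn ⟨Ioo (-a ^ 2) (a ^ 2) ×ˢ ball x₀ a, isOpen_box a x₀⟩ φ) :
    IntegrableOn (localEnergyRHS 1 0 U P φ) (parabolicCylinder a ((0 : ℝ), x₀)) := by
  have hU2 := integrableOn_norm_sq hUm hE
  have hflux := integrableOn_flux hUm hU3 hP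
  obtain ⟨Cφ, hC0, hφb, hdt, hgrad, hlap⟩ := hφ.exists_scalar_weights_bound
  have hm : AEStronglyMeasurable (localEnergyRHS 1 0 U P φ) (volume.restrict (parabolicCylinder a ((0 : ℝ), x₀))) := by
    have h1 : AEStronglyMeasurable (fun z : ℝ × E => ‖U z.1 z.2‖ ^ 2 *
        (timeDeriv φ z.1 z.2 + 1 * Δ (φ z.1) z.2)) (volume.restrict (parabolicCylinder a ((0 : ℝ), x₀))) :=
      (hUm.norm.pow 2).mul ((hφ.continuous_timeDeriv.aestronglyMeasurable).add
        (hφ.continuous_laplacian_slice.aestronglyMeasurable.const_mul 1))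
    have h2 : AEStronglyMeasurable (fun z : ℝ × E => (‖U z.1 z.2‖ ^ 2 + 2 * P z.1 z.2) *
        ⟪U z.1 z.2, gradient (φ z.1) z.2⟫) (volume.restrict (parabolicCylinder a ((0 : ℝ), x₀))) :=
      ((hUm.norm.pow 2).add (hP.aestronglyMeasurable.const_mul 2)).mul
        (hUm.inner hφ.continuous_slice_gradient.aestronglyMeasurable)
    have h3 : AEStronglyMeasurable (fun z : ℝ × E => 2 * ⟪(0 : ℝ → E → E) z.1 z.2, U z.1 z.2⟫ * φ z.1 z.2)
        (volume.restrict (parabolicCylinder a ((0 : ℝ), x₀))) := by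
      have : (fun z : ℝ × E => 2 * ⟪(0 : ℝ → E → E) z.1 z.2, U z.1 z.2⟫ * φ z.1 z.2) = fun _ => 0 := by
        funext z; simp
      rw [this]; exact aestronglyMeasurable_const
    exact (h1.add h2).add h3
  refine (((hU2.mul_const (Cφ + Cφ)).add (hflux.mul_const Cφ))).mono' hm
    (Eventually.of_forall fun z => ?_)
  rw [Real.norm_eq_abs, localEnergyRHS]
  have b1 : |‖U z.1 z.2‖ ^ 2 * (timeDeriv φ z.1 z.2 + 1 * Δ (φ z.1) z.2)| ≤
      ‖U z.1 z.2‖ ^ 2 * (Cφ + Cφ) := by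
    rw [abs_mul, abs_of_nonneg (sq_nonneg _)]
    refine mul_le_mul_of_nonneg_left ((abs_add_le _ _).trans (add_le_add ?_ ?_)) (sq_nonneg _)
    · exact (le_of_eq (Real.norm_eq_abs _).symm).trans (hdt z)
    · rw [one_mul]; exact (le_of_eq (Real.norm_eq_abs _).symm).trans (hlap z)
  have b2 : |(‖U z.1 z.2‖ ^ 2 + 2 * P z.1 z.2) * ⟪U z.1 z.2, gradient (φ z.1) z.2⟫| ≤
      (‖U z.1 z.2‖ ^ 2 + 2 * |P z.1 z.2|) * ‖U z.1 z.2‖ * Cφ := by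
    rw [abs_mul]
    have h1 : |‖U z.1 z.2‖ ^ 2 + 2 * P z.1 z.2| ≤ ‖U z.1 z.2‖ ^ 2 + 2 * |P z.1 z.2| := by
      refine (abs_add_le _ _).trans ?_
      rw [abs_of_nonneg (sq_nonneg _), abs_mul, abs_two]
    have h2 : |⟪U z.1 z.2, gradient (φ z.1) z.2⟫| ≤ ‖U z.1 z.2‖ * Cφ :=
      (abs_real_inner_le_norm _ _).trans (mul_le_mul_of_nonneg_left (hgrad z) (norm_nonneg _))
    calc |‖U z.1 z.2‖ ^ 2 + 2 * P z.1 z.2| * |⟪U z.1 z.2, gradient (φ z.1) z.2⟫|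
        ≤ (‖U z.1 z.2‖ ^ 2 + 2 * |P z.1 z.2|) * (‖U z.1 z.2‖ * Cφ) :=
          mul_le_mul h1 h2 (abs_nonneg _) (by positivity)
      _ = (‖U z.1 z.2‖ ^ 2 + 2 * |P z.1 z.2|) * ‖U z.1 z.2‖ * Cφ := by ring
  have b3 : 2 * ⟪(0 : ℝ → E → E) z.1 z.2, U z.1 z.2⟫ * φ z.1 z.2 = 0 := by simp
  rw [b3, add_zero]
  exact (abs_add_le _ _).trans (add_le_add b1 b2)

/-- **The local energy inequality on the cylinder against nonnegative tests on the box**: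
`2 ∫_{Q_a} |∇U|² φ ≤ ∫_{Q_a} R[φ]` (slices tending to the top in the tree's sliced
inequality). [folklore] -/
theorem setIntegral_cylinder_localEnergy_le (ha : 0 < a)
    (hsw : IsSuitableWeakSolutionOn (parabolicCylinderOpens a ((0 : ℝ), x₀)) 1 0 U P)
    (hG : HasWeakSpatialGradientOn (parabolicCylinderOpens a ((0 : ℝ), x₀)) U G)
    (hGfin : ∫⁻ z in parabolicCylinder a ((0 : ℝ), x₀),
      ENNReal.ofReal (frobeniusNormSq (G z.1 z.2)) < ⊤)
    {C : ℝ≥0} (hE : ∀ᵐ t ∂(volume.restrict (Ioo (-a ^ 2) 0)), ∫⁻ x in ball x₀ a, ‖U t x‖ₑ ^ 2 ≤ C)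
    (hU3 : MemLp (uncurry U) 3 (volume.restrict (parabolicCylinder a ((0 : ℝ), x₀))))
    (hP : MemLp (uncurry P) (3 / 2) (volume.restrict (parabolicCylinder a ((0 : ℝ), x₀))))
    {φ : ℝ → E → ℝ}
    (hφ : IsSpaceTimeTestOn ⟨Ioo (-a ^ 2) (a ^ 2) ×ˢ ball x₀ a, isOpen_box a x₀⟩ φ)
    (hφ0 : ∀ t x, 0 ≤ φ t x) :
    2 * ∫ z in parabolicCylinder a ((0 : ℝ), x₀), frobeniusNormSq (G z.1 z.2) * φ z.1 z.2 ≤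
      ∫ z in parabolicCylinder a ((0 : ℝ), x₀), localEnergyRHS 1 0 U P φ z := by
  have hUm : AEStronglyMeasurable (uncurry U) (volume.restrict (parabolicCylinder a ((0 : ℝ), x₀))) := by
    have := hsw.distributional.1.aestronglyMeasurable; rwa [coe_parabolicCylinderOpens] at this
  have hUint := integrableOn_velocity hUm hE
  have hU2 := integrableOn_norm_sq hUm hE
  have hU3int := integrableOn_norm_cube hU3
  have hflux := integrableOn_flux hUm hU3 hP
  obtain ⟨-, hF⟩ := integrableOn_grad hG hGfin
  obtain ⟨Cφ, hC0, hφb, hdt, hgrad, hlap⟩ := hφ.exists_scalar_weights_bound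
  -- the sliced inequality, below every level `τ < 0`
  have hu3 : LocallyIntegrableOn (fun z : ℝ × E => ‖U z.1 z.2‖ ^ 3)
      ((parabolicCylinderOpens a ((0 : ℝ), x₀) : Opens (ℝ × E)) : Set (ℝ × E)) volume := by
    rw [coe_parabolicCylinderOpens]; exact hU3int.locallyIntegrableOn
  have hfu : LocallyIntegrableOn (fun z : ℝ × E => ⟪(0 : ℝ → E → E) z.1 z.2, U z.1 z.2⟫)
      ((parabolicCylinderOpens a ((0 : ℝ), x₀) : Opens (ℝ × E)) : Set (ℝ × E)) volume := by
    have : (fun z : ℝ × E => ⟪(0 : ℝ → E → E) z.1 z.2, U z.1 z.2⟫) = fun _ => 0 := by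
      funext z; simp
    rw [this]; exact locallyIntegrableOn_const _
  have hζ : IsSpaceTimeTestOn (⊤ : Opens (ℝ × E)) φ := hφ.mono le_top
  have hζQ : ∀ τ < (0 : ℝ), tsupport (uncurry φ) ∩ {z : ℝ × E | z.1 ≤ τ} ⊆
      ((parabolicCylinderOpens a ((0 : ℝ), x₀) : Opens (ℝ × E)) : Set (ℝ × E)) := by
    intro τ hτ
    rw [coe_parabolicCylinderOpens]
    exact inter_le_subset_parabolicCylinder ha x₀ hφ.tsupport_subset hτ
  have hae := hsw.ae_localEnergy_slice_of_forall_lt hG hu3 hfu hζ hφ0 hζQ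
  -- the two integrands on the half-spaces, and their integrability
  have hmeas : ∀ s : ℝ, MeasurableSet {z : ℝ × E | z.1 < s} := fun s =>
    measurableSet_lt measurable_fst measurable_const
  set FL : ℝ × E → ℝ := fun z => frobeniusNormSq (G z.1 z.2) * φ z.1 z.2 with hFL
  set FR : ℝ × E → ℝ := localEnergyRHS 1 0 U P φ with hFR
  -- both vanish off the cylinder on `{t < 0}`
  have hnot : ∀ z : ℝ × E, z.1 < 0 → z ∉ parabolicCylinder a ((0 : ℝ), x₀) →
      z ∉ (Ioo (-a ^ 2) (a ^ 2) ×ˢ ball x₀ a) := by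
    intro z hz hzQ hzb
    exact hzQ (by rw [← box_inter_neg_eq ha]; exact ⟨hzb, hz⟩)
  have hFL0 : ∀ z : ℝ × E, z.1 < 0 → z ∉ parabolicCylinder a ((0 : ℝ), x₀) → FL z = 0 := by
    intro z hz hzQ
    have : φ z.1 z.2 = 0 := hφ.apply_eq_zero (hnot z hz hzQ)
    simp only [hFL, this, mul_zero]
  have hFR0 : ∀ z : ℝ × E, z.1 < 0 → z ∉ parabolicCylinder a ((0 : ℝ), x₀) → FR z = 0 := by
    intro z hz hzQ
    have h0 := hnot z hz hzQ
    have e1 : timeDeriv φ z.1 z.2 = 0 := hφ.timeDeriv_eq_zero h0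
    have e2 : Δ (φ z.1) z.2 = 0 := hφ.laplacian_slice_eq_zero h0
    have e3 : gradient (φ z.1) z.2 = 0 := by
      rw [gradient, hφ.fderiv_slice_eq_zero h0, map_zero]
    have e4 : φ z.1 z.2 = 0 := hφ.apply_eq_zero h0
    simp only [hFR, localEnergyRHS, e1, e2, e3, e4, inner_zero_right, mul_zero, add_zero]
  -- integrability on the cylinder
  have hFLint : IntegrableOn FL (parabolicCylinder a ((0 : ℝ), x₀)) :=
    (hF.mul_const Cφ).mono' (hF.aestronglyMeasurable.mul hφ.contDiff.continuous.aestronglyMeasurable)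
      (Eventually.of_forall fun z => by
        rw [Real.norm_eq_abs, hFL, abs_mul, abs_of_nonneg (frobeniusNormSq_nonneg _)]
        exact mul_le_mul_of_nonneg_left ((le_of_eq (Real.norm_eq_abs _).symm).trans (hφb z))
          (frobeniusNormSq_nonneg _))
  have hFRint : IntegrableOn FR (parabolicCylinder a ((0 : ℝ), x₀)) := by
    have hm : AEStronglyMeasurable FR (volume.restrict (parabolicCylinder a ((0 : ℝ), x₀))) := by
      have h1 : AEStronglyMeasurable (fun z : ℝ × E => ‖U z.1 z.2‖ ^ 2 *
          (timeDeriv φ z.1 z.2 + 1 * Δ (φ z.1) z.2)) (volume.restrict (parabolicCylinder a ((0 : ℝ), x₀))) :=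
        (hUm.norm.pow 2).mul ((hφ.continuous_timeDeriv.aestronglyMeasurable).add
          (hφ.continuous_laplacian_slice.aestronglyMeasurable.const_mul 1))
      have h2 : AEStronglyMeasurable (fun z : ℝ × E => (‖U z.1 z.2‖ ^ 2 + 2 * P z.1 z.2) *
          ⟪U z.1 z.2, gradient (φ z.1) z.2⟫) (volume.restrict (parabolicCylinder a ((0 : ℝ), x₀))) :=
        ((hUm.norm.pow 2).add (hP.aestronglyMeasurable.const_mul 2)).mul
          (hUm.inner hφ.continuous_slice_gradient.aestronglyMeasurable)
      have h3 : AEStronglyMeasurable (fun z : ℝ × E => 2 * ⟪(0 : ℝ → E → E) z.1 z.2, U z.1 z.2⟫ * φ z.1 z.2)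
          (volume.restrict (parabolicCylinder a ((0 : ℝ), x₀))) := by
        have : (fun z : ℝ × E => 2 * ⟪(0 : ℝ → E → E) z.1 z.2, U z.1 z.2⟫ * φ z.1 z.2) = fun _ => 0 := by
          funext z; simp
        rw [this]; exact aestronglyMeasurable_const
      exact (h1.add h2).add h3
    refine (((hU2.mul_const (Cφ + Cφ)).add (hflux.mul_const Cφ))).mono' hm
      (Eventually.of_forall fun z => ?_)
    rw [Real.norm_eq_abs, hFR, localEnergyRHS]
    have hPz : |P z.1 z.2| ≤ |P z.1 z.2| := le_rfl
    have b1 : |‖U z.1 z.2‖ ^ 2 * (timeDeriv φ z.1 z.2 + 1 * Δ (φ z.1) z.2)| ≤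
        ‖U z.1 z.2‖ ^ 2 * (Cφ + Cφ) := by
      rw [abs_mul, abs_of_nonneg (sq_nonneg _)]
      refine mul_le_mul_of_nonneg_left ((abs_add_le _ _).trans (add_le_add ?_ ?_)) (sq_nonneg _)
      · exact (le_of_eq (Real.norm_eq_abs _).symm).trans (hdt z)
      · rw [one_mul]; exact (le_of_eq (Real.norm_eq_abs _).symm).trans (hlap z)
    have b2 : |(‖U z.1 z.2‖ ^ 2 + 2 * P z.1 z.2) * ⟪U z.1 z.2, gradient (φ z.1) z.2⟫| ≤
        (‖U z.1 z.2‖ ^ 2 + 2 * |P z.1 z.2|) * ‖U z.1 z.2‖ * Cφ := by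
      rw [abs_mul]
      have h1 : |‖U z.1 z.2‖ ^ 2 + 2 * P z.1 z.2| ≤ ‖U z.1 z.2‖ ^ 2 + 2 * |P z.1 z.2| := by
        refine (abs_add_le _ _).trans ?_
        rw [abs_of_nonneg (sq_nonneg _), abs_mul, abs_two]
      have h2 : |⟪U z.1 z.2, gradient (φ z.1) z.2⟫| ≤ ‖U z.1 z.2‖ * Cφ :=
        (abs_real_inner_le_norm _ _).trans (mul_le_mul_of_nonneg_left (hgrad z) (norm_nonneg _))
      calc |‖U z.1 z.2‖ ^ 2 + 2 * P z.1 z.2| * |⟪U z.1 z.2, gradient (φ z.1) z.2⟫|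
          ≤ (‖U z.1 z.2‖ ^ 2 + 2 * |P z.1 z.2|) * (‖U z.1 z.2‖ * Cφ) :=
            mul_le_mul h1 h2 (abs_nonneg _) (by positivity)
        _ = (‖U z.1 z.2‖ ^ 2 + 2 * |P z.1 z.2|) * ‖U z.1 z.2‖ * Cφ := by ring
    have b3 : 2 * ⟪(0 : ℝ → E → E) z.1 z.2, U z.1 z.2⟫ * φ z.1 z.2 = 0 := by simp
    rw [b3, add_zero]
    exact (abs_add_le _ _).trans (add_le_add b1 b2)
  -- good slices `s_n ↑ 0`
  have hex : ∀ n : ℕ, ∃ s ∈ Ioo (-(1 / ((n : ℝ) + 1))) (0 : ℝ),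
      (∫ x, ‖U s x‖ ^ 2 * φ s x) + 2 * 1 * ∫ z in {z : ℝ × E | z.1 < s}, FL z ≤
        ∫ z in {z : ℝ × E | z.1 < s}, FR z := by
    intro n
    have hpos : (0 : ℝ) < 1 / ((n : ℝ) + 1) := by positivity
    have hμ : volume (Ioo (-(1 / ((n : ℝ) + 1))) (0 : ℝ)) ≠ 0 := by
      rw [Real.volume_Ioo, Ne, ENNReal.ofReal_eq_zero, not_le]
      linarith
    haveI : (ae (volume.restrict (Ioo (-(1 / ((n : ℝ) + 1))) (0 : ℝ)))).NeBot :=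
      ae_neBot.2 (by rwa [Ne, Measure.restrict_eq_zero])
    obtain ⟨s, hs, hPs⟩ := ((ae_restrict_mem measurableSet_Ioo).and
      (ae_restrict_of_ae (s := Ioo (-(1 / ((n : ℝ) + 1))) 0) hae)).exists
    exact ⟨s, hs, hPs hs.2⟩
  choose sq hsq hgood using hex
  -- on `{t < s}` the integrals live on the cylinder
  have hcut : ∀ {F : ℝ × E → ℝ}, IntegrableOn F (parabolicCylinder a ((0 : ℝ), x₀)) →
      (∀ z : ℝ × E, z.1 < 0 → z ∉ parabolicCylinder a ((0 : ℝ), x₀) → F z = 0) →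
      ∀ s ≤ (0 : ℝ), ∫ z in {z : ℝ × E | z.1 < s}, F z =
        ∫ z in parabolicCylinder a ((0 : ℝ), x₀), {w : ℝ × E | w.1 < s}.indicator F z := by
    intro F hFi hF0 s hs
    rw [setIntegral_indicator (hmeas s), Set.inter_comm]
    refine setIntegral_eq_of_subset_of_forall_sdiff_eq_zero (hmeas s) inter_subset_left ?_
    rintro z ⟨hz, hz'⟩
    exact hF0 z (lt_of_lt_of_le hz hs) fun h => hz' ⟨hz, h⟩
  -- dominated convergence along the slices
  have htend : ∀ {F : ℝ × E → ℝ}, IntegrableOn F (parabolicCylinder a ((0 : ℝ), x₀)) →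
      Tendsto (fun n => ∫ z in parabolicCylinder a ((0 : ℝ), x₀), {w : ℝ × E | w.1 < sq n}.indicator F z)
        atTop (𝓝 (∫ z in parabolicCylinder a ((0 : ℝ), x₀), F z)) := by
    intro F hFi
    refine tendsto_integral_of_dominated_convergence (fun z => ‖F z‖)
      (fun n => hFi.aestronglyMeasurable.indicator (hmeas _)) hFi.norm
      (fun n => Eventually.of_forall fun z => ?_) ?_
    · rw [norm_indicator_eq_indicator_norm]
      exact indicator_le_self' (fun _ _ => norm_nonneg _) z
    · rw [parabolicCylinder_zero_eq]
      filter_upwards [ae_restrict_mem (measurableSet_Ioo.prod measurableSet_ball)] with z hz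
      have hz0 : z.1 < 0 := hz.1.2
      obtain ⟨N, hN⟩ := exists_nat_one_div_lt (by linarith : 0 < -z.1)
      refine tendsto_atTop_of_eventually_const (i₀ := N) fun n hn => ?_
      have hn' : (1 : ℝ) / ((n : ℝ) + 1) ≤ 1 / ((N : ℝ) + 1) := by
        apply one_div_le_one_div_of_le (by positivity)
        exact_mod_cast Nat.succ_le_succ hn
      have : z ∈ {w : ℝ × E | w.1 < sq n} := by
        show z.1 < sq n
        linarith [(hsq n).1]
      rw [indicator_of_mem this]
  have hLt := htend hFLint
  have hRt := htend hFRint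
  -- the inequality along the slices, then in the limit
  have hineq : ∀ n, 2 * ∫ z in parabolicCylinder a ((0 : ℝ), x₀), {w : ℝ × E | w.1 < sq n}.indicator FL z ≤
      ∫ z in parabolicCylinder a ((0 : ℝ), x₀), {w : ℝ × E | w.1 < sq n}.indicator FR z := by
    intro n
    have h := hgood n
    rw [hcut hFLint hFL0 _ (hsq n).2.le, hcut hFRint hFR0 _ (hsq n).2.le] at h
    have h0 : 0 ≤ ∫ x, ‖U (sq n) x‖ ^ 2 * φ (sq n) x :=
      integral_nonneg fun x => mul_nonneg (sq_nonneg _) (hφ0 _ _)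
    linarith
  exact le_of_tendsto_of_tendsto (hLt.const_mul 2) hRt (Eventually.of_forall hineq)

end Energy

/-! ### The extension by zero -/

section Assembly

variable {a : ℝ} {x₀ : E} {U : ℝ → E → E} {P : ℝ → E → ℝ}

omit [NormedAddCommGroup E] [InnerProductSpace ℝ E] [FiniteDimensional ℝ E] [MeasurableSpace E]
  [BorelSpace E] in
/-- The zero extension of a function of space–time past `t = 0`, uncurried, is the indicator of
`{t < 0}`. [folklore] -/
theorem uncurry_ite_eq_indicator {F : Type*} [Zero F] (V : ℝ → E → F) :
    uncurry (fun t x => if t < 0 then V t x else 0) =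
      {z : ℝ × E | z.1 < 0}.indicator (uncurry V) := by
  funext z
  by_cases hz : z.1 < 0
  · rw [indicator_of_mem (show z ∈ {z : ℝ × E | z.1 < 0} from hz)]
    simp [uncurry, hz]
  · rw [indicator_of_notMem (show z ∉ {z : ℝ × E | z.1 < 0} from hz)]
    simp [uncurry, hz]

/-- Integrability on the box of an indicator of `{t < 0}` is integrability on the cylinder. [folklore] -/
theorem integrableOn_box_indicator {F : Type*} [NormedAddCommGroup F] (ha : 0 < a) {f : ℝ × E → F}
    (hf : IntegrableOn f (parabolicCylinder a ((0 : ℝ), x₀))) :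
    IntegrableOn ({z : ℝ × E | z.1 < 0}.indicator f) (Ioo (-a ^ 2) (a ^ 2) ×ˢ ball x₀ a) := by
  have hmeas : MeasurableSet {z : ℝ × E | z.1 < 0} := measurableSet_lt measurable_fst measurable_const
  rw [IntegrableOn, integrable_indicator_iff hmeas, IntegrableOn, Measure.restrict_restrict hmeas,
    Set.inter_comm, box_inter_neg_eq ha]
  exact hf

/-- Set integrals over the box of indicators of `{t < 0}` are integrals over the cylinder. [folklore] -/
theorem setIntegral_box_indicator {F : Type*} [NormedAddCommGroup F] [NormedSpace ℝ F] (ha : 0 < a)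
    (f : ℝ × E → F) :
    ∫ z in Ioo (-a ^ 2) (a ^ 2) ×ˢ ball x₀ a, {w : ℝ × E | w.1 < 0}.indicator f z =
      ∫ z in parabolicCylinder a ((0 : ℝ), x₀), f z := by
  rw [setIntegral_indicator (measurableSet_lt measurable_fst measurable_const), box_inter_neg_eq ha]

/-- Lower integrals over compact subsets of the box of indicators of `{t < 0}` are bounded by lower
integrals over the cylinder. [folklore] -/
theorem lintegral_compact_indicator_le (ha : 0 < a) {K : Set (ℝ × E)}
    (hK : K ⊆ Ioo (-a ^ 2) (a ^ 2) ×ˢ ball x₀ a) (f : ℝ × E → ℝ≥0∞) :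
    ∫⁻ z in K, {w : ℝ × E | w.1 < 0}.indicator f z ≤ ∫⁻ z in parabolicCylinder a ((0 : ℝ), x₀), f z := by
  rw [lintegral_indicator (measurableSet_lt measurable_fst measurable_const), Measure.restrict_restrict
    (measurableSet_lt measurable_fst measurable_const)]
  refine lintegral_mono_set ?_
  rw [Set.inter_comm, ← box_inter_neg_eq ha]
  exact inter_subset_inter_left _ hK

/-- **Extension by zero past a weakly vanishing final time.** Let `(U, P)` be a suitable weak
solution in `Q_a(0, x₀)` with `U ∈ L^∞_t L²_x`, `∇U ∈ L²`, `U ∈ L³`, `P ∈ L^{3/2}` of the whole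
cylinder, and suppose `U(s) ⇀ 0` as `s → 0⁻` (for every smooth compactly supported field `φ`
in the ball and `η > 0`: `|∫ ⟪U(s), φ⟫| ≤ η` for a.e. `s ∈ (-δ, 0)`, some `δ > 0`). Then the pair
extended by zero for `t ≥ 0` is a suitable weak solution in the box `(-a², a²) × B(x₀, a)`.
[cite: CaffarelliKohnNirenberg1982, §2 (2.1)–(2.5); SereginSverak2002 §4] -/
theorem isSuitableWeakSolutionOn (ha : 0 < a)
    (hsw : IsSuitableWeakSolutionOn (parabolicCylinderOpens a ((0 : ℝ), x₀)) 1 0 U P)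
    (hE : ∃ C : ℝ≥0, ∀ᵐ t ∂(volume.restrict (Ioo (-a ^ 2) 0)), ∫⁻ x in ball x₀ a, ‖U t x‖ₑ ^ 2 ≤ C)
    (hG : ∃ G : ℝ → E → E →L[ℝ] E, HasWeakSpatialGradientOn (parabolicCylinderOpens a ((0 : ℝ), x₀)) U G ∧
      ∫⁻ z in parabolicCylinder a ((0 : ℝ), x₀), ENNReal.ofReal (frobeniusNormSq (G z.1 z.2)) < ⊤)
    (hU3 : MemLp (uncurry U) 3 (volume.restrict (parabolicCylinder a ((0 : ℝ), x₀))))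
    (hP : MemLp (uncurry P) (3 / 2) (volume.restrict (parabolicCylinder a ((0 : ℝ), x₀))))
    (hvan : ∀ φ : E → E, ContDiff ℝ (⊤ : ℕ∞) φ → HasCompactSupport φ → tsupport φ ⊆ ball x₀ a →
      ∀ η > 0, ∃ δ > 0, ∀ᵐ s ∂(volume : Measure ℝ), s ∈ Ioo (-δ) 0 → |∫ x, ⟪U s x, φ x⟫| ≤ η) :
    IsSuitableWeakSolutionOn ⟨Ioo (-a ^ 2) (a ^ 2) ×ˢ ball x₀ a, isOpen_box a x₀⟩ 1 0
      (fun t x => if t < 0 then U t x else 0) (fun t x => if t < 0 then P t x else 0) := by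
  obtain ⟨C, hE⟩ := hE
  obtain ⟨G, hG, hGfin⟩ := hG
  have hUm : AEStronglyMeasurable (uncurry U) (volume.restrict (parabolicCylinder a ((0 : ℝ), x₀))) := by
    have := hsw.distributional.1.aestronglyMeasurable; rwa [coe_parabolicCylinderOpens] at this
  have hUint := integrableOn_velocity hUm hE
  have hU2 := integrableOn_norm_sq hUm hE
  obtain ⟨hPint, -⟩ := integrableOn_pressure hP
  obtain ⟨hGint, -⟩ := integrableOn_grad hG hGfin
  have hmeas : MeasurableSet {z : ℝ × E | z.1 < 0} := measurableSet_lt measurable_fst measurable_const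
  have hbox : ((⟨Ioo (-a ^ 2) (a ^ 2) ×ˢ ball x₀ a, isOpen_box a x₀⟩ : Opens (ℝ × E)) : Set (ℝ × E)) =
      Ioo (-a ^ 2) (a ^ 2) ×ˢ ball x₀ a := rfl
  have hin : ∀ {z : ℝ × E}, z.1 < 0 → z ∈ {z : ℝ × E | z.1 < 0} := fun h => h
  have hout : ∀ {z : ℝ × E}, ¬ z.1 < 0 → z ∉ {z : ℝ × E | z.1 < 0} := fun h => h
  refine ⟨⟨?_, ?_, ?_, ?_, ?_⟩, ?_, ?_, ?_⟩
  · -- `Ũ ∈ L¹_loc`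
    rw [hbox, uncurry_ite_eq_indicator]
    exact (integrableOn_box_indicator ha hUint).locallyIntegrableOn
  · -- `|Ũ|² ∈ L¹_loc`
    rw [hbox]
    have : (fun z : ℝ × E => ‖uncurry (fun t x => if t < 0 then U t x else 0) z‖ ^ 2) =
        {z : ℝ × E | z.1 < 0}.indicator fun z => ‖U z.1 z.2‖ ^ 2 := by
      funext z
      by_cases hz : z.1 < 0
      · rw [indicator_of_mem (hin hz)]; simp [uncurry, hz]
      · rw [indicator_of_notMem (hout hz)]; simp [uncurry, hz]
    rw [this]
    exact (integrableOn_box_indicator ha hU2).locallyIntegrableOn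
  · -- `P̃ ∈ L¹_loc`
    rw [hbox, uncurry_ite_eq_indicator]
    exact (integrableOn_box_indicator ha hPint).locallyIntegrableOn
  · -- `div Ũ = 0`
    intro θ hθ
    rw [hbox]
    have : (fun z : ℝ × E => ⟪(fun t x => if t < 0 then U t x else 0) z.1 z.2, gradient (θ z.1) z.2⟫) =
        {z : ℝ × E | z.1 < 0}.indicator fun z => ⟪U z.1 z.2, gradient (θ z.1) z.2⟫ := by
      funext z
      by_cases hz : z.1 < 0
      · rw [indicator_of_mem (hin hz)]; simp [hz]
      · rw [indicator_of_notMem (hout hz)]; simp [hz]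
    rw [this, setIntegral_box_indicator ha]
    exact setIntegral_cylinder_inner_gradient_eq_zero ha hsw.distributional hE hθ
  · -- the momentum equation
    intro ψ hψ
    rw [hbox]
    have : (fun z : ℝ × E =>
        ⟪(fun t x => if t < 0 then U t x else 0) z.1 z.2, timeDeriv ψ z.1 z.2⟫ +
          ⟪(fun t x => if t < 0 then U t x else 0) z.1 z.2,
            convect ((fun t x => if t < 0 then U t x else 0) z.1) (ψ z.1) z.2⟫ +
          1 * ⟪(fun t x => if t < 0 then U t x else 0) z.1 z.2, Δ (ψ z.1) z.2⟫ +
          (fun t x => if t < 0 then P t x else 0) z.1 z.2 * VectorCalculus.divergence (ψ z.1) z.2 +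
          ⟪(0 : ℝ → E → E) z.1 z.2, ψ z.1 z.2⟫) =
        {z : ℝ × E | z.1 < 0}.indicator fun z =>
          ⟪U z.1 z.2, timeDeriv ψ z.1 z.2⟫ + ⟪U z.1 z.2, convect (U z.1) (ψ z.1) z.2⟫ +
            1 * ⟪U z.1 z.2, Δ (ψ z.1) z.2⟫ + P z.1 z.2 * VectorCalculus.divergence (ψ z.1) z.2 := by
      funext z
      by_cases hz : z.1 < 0
      · rw [indicator_of_mem (hin hz)]
        simp only [hz, if_true, Pi.zero_apply, inner_zero_left, add_zero]
      · rw [indicator_of_notMem (hout hz)]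
        simp [hz]
    rw [this, setIntegral_box_indicator ha]
    exact setIntegral_cylinder_momentum_eq_zero ha hsw.distributional hE hP hvan hψ
  · -- energy class
    intro K hK _
    refine ⟨C, ?_⟩
    have hE' := (ae_restrict_iff' measurableSet_Ioo).1 hE
    filter_upwards [hE'] with t ht
    have hpt : ∀ x, K.indicator (fun z : ℝ × E => ‖(fun t x => if t < 0 then U t x else 0) z.1 z.2‖ₑ ^ 2) (t, x) ≤
        (Ioo (-a ^ 2) 0).indicator (fun _ => (1 : ℝ≥0∞)) t *
          (ball x₀ a).indicator (fun x => ‖U t x‖ₑ ^ 2) x := by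
      intro x
      by_cases hx : (t, x) ∈ K
      · rw [indicator_of_mem hx]
        have hbx : (t, x) ∈ Ioo (-a ^ 2) (a ^ 2) ×ˢ ball x₀ a := hK hx
        by_cases ht0 : t < 0
        · rw [indicator_of_mem (show t ∈ Ioo (-a ^ 2) 0 from ⟨hbx.1.1, ht0⟩), indicator_of_mem hbx.2,
            one_mul]
          simp [ht0]
        · simp [ht0]
      · rw [indicator_of_notMem hx]; exact bot_le
    refine (lintegral_mono hpt).trans ?_
    by_cases ht0 : t ∈ Ioo (-a ^ 2) 0
    · rw [indicator_of_mem ht0]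
      simp only [one_mul]
      rw [lintegral_indicator measurableSet_ball]
      exact ht ht0
    · rw [indicator_of_notMem ht0]
      simp
  · -- pressure class
    intro K hK _
    have h32 : ((3 : ℝ≥0∞) / 2).toReal = (3 / 2 : ℝ) := by rw [ENNReal.toReal_div]; norm_num
    have hfin : ∫⁻ z in parabolicCylinder a ((0 : ℝ), x₀), ‖P z.1 z.2‖ₑ ^ (3 / 2 : ℝ) < ⊤ := by
      have := lintegral_rpow_enorm_lt_top_of_eLpNorm_lt_top (by simp) (by simp [ENNReal.div_eq_top]) hP.2
      rw [h32] at this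
      exact this
    refine lt_of_le_of_lt ?_ hfin
    rw [hbox] at hK
    refine le_trans (le_of_eq (lintegral_congr fun z => ?_))
      (lintegral_compact_indicator_le ha hK (fun z : ℝ × E => ‖P z.1 z.2‖ₑ ^ (3 / 2 : ℝ)))
    by_cases hz : z.1 < 0
    · rw [indicator_of_mem (hin hz)]; simp [hz]
    · rw [indicator_of_notMem (hout hz)]
      simp [hz, ENNReal.zero_rpow_of_pos (by norm_num : (0 : ℝ) < 3 / 2)]
  · -- the weak gradient and the local energy inequality
    have hQm : MeasurableSet (parabolicCylinder a ((0 : ℝ), x₀)) := by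
      rw [parabolicCylinder_zero_eq]; exact measurableSet_Ioo.prod measurableSet_ball
    have hQneg : ∀ z ∈ parabolicCylinder a ((0 : ℝ), x₀), z.1 < 0 := fun z hz => by
      rw [parabolicCylinder_zero_eq] at hz; exact hz.1.2
    refine ⟨fun t x => if t < 0 then G t x else 0, ⟨?_, ?_, ?_⟩, ?_, ?_⟩
    · rw [hbox, uncurry_ite_eq_indicator]
      exact (integrableOn_box_indicator ha hUint).locallyIntegrableOn
    · rw [hbox, uncurry_ite_eq_indicator]
      exact (integrableOn_box_indicator ha hGint).locallyIntegrableOn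
    · intro φ hφ v w
      -- the two integrands, as functions on space–time
      set HL : ℝ × E → ℝ := fun z => fderiv ℝ (φ z.1) z.2 v *
        ⟪(fun t x => if t < 0 then U t x else 0) z.1 z.2, w⟫ with hHL
      set HR : ℝ × E → ℝ := fun z => φ z.1 z.2 *
        ⟪(fun t x => if t < 0 then G t x else 0) z.1 z.2 v, w⟫ with hHR
      have hL0 : ∀ z, z ∉ parabolicCylinder a ((0 : ℝ), x₀) → HL z = 0 := by
        intro z hz
        by_cases hz0 : z.1 < 0
        · have : fderiv ℝ (φ z.1) z.2 = 0 :=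
            hφ.fderiv_slice_eq_zero (notMem_box_of_neg_of_notMem_cylinder ha hz0 hz)
          simp only [hHL, this]; simp
        · simp only [hHL, hz0, if_false, inner_zero_left, mul_zero]
      have hR0 : ∀ z, z ∉ parabolicCylinder a ((0 : ℝ), x₀) → HR z = 0 := by
        intro z hz
        by_cases hz0 : z.1 < 0
        · have : φ z.1 z.2 = 0 := hφ.apply_eq_zero (notMem_box_of_neg_of_notMem_cylinder ha hz0 hz)
          simp only [hHR, this, zero_mul]
        · simp only [hHR, hz0, if_false]; simp
      have hLeq : EqOn (fun z : ℝ × E => fderiv ℝ (φ z.1) z.2 v * ⟪U z.1 z.2, w⟫) HL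
          (parabolicCylinder a ((0 : ℝ), x₀)) := fun z hz => by
        simp only [hHL, hQneg z hz, if_true]
      have hReq : EqOn (fun z : ℝ × E => φ z.1 z.2 * ⟪G z.1 z.2 v, w⟫) HR
          (parabolicCylinder a ((0 : ℝ), x₀)) := fun z hz => by
        simp only [hHR, hQneg z hz, if_true]
      have hLint : IntegrableOn HL (parabolicCylinder a ((0 : ℝ), x₀)) :=
        (integrableOn_fderiv_mul_inner hUm hE hφ v w).congr_fun hLeq hQm
      have hRint : IntegrableOn HR (parabolicCylinder a ((0 : ℝ), x₀)) :=
        (integrableOn_mul_inner_grad hG hGfin hφ v w).congr_fun hReq hQm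
      have hL := integral_integral_eq_setIntegral hLint hL0
      have hR := integral_integral_eq_setIntegral hRint hR0
      show ∫ t, ∫ x, HL (t, x) = -∫ t, ∫ x, HR (t, x)
      rw [hL, hR, ← setIntegral_congr_fun hQm hLeq, ← setIntegral_congr_fun hQm hReq]
      exact setIntegral_cylinder_fderiv_mul_inner_eq ha hG hGfin hE hφ v w
    · -- `∇Ũ ∈ L²` of compact subsets of the box
      intro K hK _
      rw [hbox] at hK
      refine lt_of_le_of_lt ?_ hGfin
      refine le_trans (le_of_eq (lintegral_congr fun z => ?_))
        (lintegral_compact_indicator_le ha hK (fun z : ℝ × E => ENNReal.ofReal (frobeniusNormSq (G z.1 z.2))))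
      by_cases hz : z.1 < 0
      · rw [indicator_of_mem (hin hz)]; simp [hz]
      · rw [indicator_of_notMem (hout hz)]
        simp [hz, frobeniusNormSq]
    · -- the local energy inequality
      intro φ hφ hφ0
      set FL : ℝ × E → ℝ := fun z =>
        frobeniusNormSq ((fun t x => if t < 0 then G t x else 0) z.1 z.2) * φ z.1 z.2 with hFL
      set FR : ℝ × E → ℝ := localEnergyRHS 1 0 (fun t x => if t < 0 then U t x else 0)
        (fun t x => if t < 0 then P t x else 0) φ with hFR
      have hFL0 : ∀ z, z ∉ parabolicCylinder a ((0 : ℝ), x₀) → FL z = 0 := by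
        intro z hz
        by_cases hz0 : z.1 < 0
        · have : φ z.1 z.2 = 0 := hφ.apply_eq_zero (notMem_box_of_neg_of_notMem_cylinder ha hz0 hz)
          simp only [hFL, this, mul_zero]
        · simp only [hFL, hz0, if_false]; simp [frobeniusNormSq]
      have hFR0 : ∀ z, z ∉ parabolicCylinder a ((0 : ℝ), x₀) → FR z = 0 := by
        intro z hz
        by_cases hz0 : z.1 < 0
        · exact localEnergyRHS_eq_zero_of_neg_of_notMem ha hφ hz0 hz
        · simp [hFR, localEnergyRHS, hz0]
      have hFLeq : EqOn (fun z : ℝ × E => frobeniusNormSq (G z.1 z.2) * φ z.1 z.2) FL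
          (parabolicCylinder a ((0 : ℝ), x₀)) := fun z hz => by
        simp only [hFL, hQneg z hz, if_true]
      have hFReq : EqOn (localEnergyRHS 1 0 U P φ) FR (parabolicCylinder a ((0 : ℝ), x₀)) := fun z hz => by
        simp only [hFR, localEnergyRHS, hQneg z hz, if_true]
      have hFLint : IntegrableOn FL (parabolicCylinder a ((0 : ℝ), x₀)) :=
        (integrableOn_frob_mul hG hGfin hφ).congr_fun hFLeq hQm
      have hFRint : IntegrableOn FR (parabolicCylinder a ((0 : ℝ), x₀)) :=
        (integrableOn_localEnergyRHS hUm hE hU3 hP hφ).congr_fun hFReq hQm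
      have hL := integral_integral_eq_setIntegral hFLint hFL0
      have hR := integral_integral_eq_setIntegral hFRint hFR0
      have hmain := setIntegral_cylinder_localEnergy_le ha hsw hG hGfin hE hU3 hP hφ hφ0
      rw [setIntegral_congr_fun hQm hFLeq, setIntegral_congr_fun hQm hFReq, ← hL, ← hR] at hmain
      have eR : (∫ t, ∫ x, FR (t, x)) = ∫ t, ∫ x,
          (‖(fun t x => if t < 0 then U t x else 0) t x‖ ^ 2 * (timeDeriv φ t x + 1 * Δ (φ t) x) +
            (‖(fun t x => if t < 0 then U t x else 0) t x‖ ^ 2 +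
              2 * (fun t x => if t < 0 then P t x else 0) t x) *
              ⟪(fun t x => if t < 0 then U t x else 0) t x, gradient (φ t) x⟫ +
            2 * ⟪(0 : ℝ → E → E) t x, (fun t x => if t < 0 then U t x else 0) t x⟫ * φ t x) := by
        rfl
      rw [eR] at hmain
      simpa only [mul_one] using hmain

end Assembly

end ZeroExtension

end Literature.Analysis.FluidPDE

end
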